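import Summits.PneNP.PneNP.Theses.OneSlice
import Literature.Computability.Complexity.RossmanMonotoneClique
import Literature.Computability.Complexity.Rossman2008CliqueProofs
import Literature.Computability.Complexity.CircuitLowerBoundsProofs
import Literature.Computability.Complexity.RossmanMonotoneCliqueGraphs
import Literature.Computability.Complexity.RossmanMonotoneCliqueLemma23Proofs
import Literature.Computability.Complexity.CliqueThresholdBounds
import Literature.Computability.Complexity.ProductWeights
import Literature.Computability.Complexity.RossmanMonotoneCliqueApprox
import Literature.Computability.Complexity.RossmanMonotoneCliqueCounting

/-!
# Disproof of `SingleThreshold` — findings (cdisprove seat, standing adversary; cycles 1–2)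

Crux `Summit.PneNP.PneNP.Theses.OneSlice.SingleThreshold` (item stmt-PneNP-2833, route
route-PneNP-OneSlice): `∀ c ∃ k ≥ 3 ∃ δ > 0 ∀ᶠ n, every monotone {∧₂,∨₂}-circuit C on the edges of
K_n with Pr_{G(n, n^{-2/(k-1)})}[C ≠ CLIQUE_k] ≤ δ has n^c < |C|`.

LANDED (kernel-checked, by name, importable): `Summits/PneNP/PneNP/Theorems/SingleThreshold/Negative/`
`LoadBearing.lean` (p73624: §0–§3 = (a)–(c) below), `EquivAAS.lean` (p75575: (d)–(e)), `Density.lean`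
(p75591: (f)–(g)), `Independence.lean` (p75617: (h.1)–(h.3)), `Locality.lean` (p76586: (h.4)–(h.5)),
namespace `Summit.PneNP.PneNP.Theorems.SingleThreshold.Negative` — ideators / planners / leads should
IMPORT those rather than this workfile (which additionally carries only the (z) frontier `sorry`).
CYCLE 2 (gen-2 seat, 2026-08-16): new section **(i) Targets** below = the `-- Targets` analysis of the
ACTIVE skeleton `Lines/self-noise-closure.lean` (sha 38768f89…, 5 stubs); its Lean content is filed for
landing as `Negative/PlantedCliqueFree.lean` (p79009) + `Negative/CriticalDecay.lean` +
`Negative/PositiveTrigger.lean` (proposal ids in the item's evidence notes; import those once merged).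

VERDICT SO FAR: **no kill; resists.** `¬SingleThreshold` unfolds to: ONE exponent `c` such that for
EVERY `k ≥ 3` and every `δ > 0`, infinitely often in `n`, some monotone circuit of size `≤ n^c` is
`δ`-accurate for `k`-CLIQUE on the critical `G(n,p)` — a fixed-exponent average-case clique detector
at the threshold for all `k`. Best known: `n^{k/4+O(1)}` (Rossman 2010 Thm 3, exponent grows with
`k`); the AC⁰ analogue of the crux is a THEOREM (Rossman 2008, single threshold), so a counterexample
family must have unbounded depth and aggregate `≫ √m` live counting gates; no such construction or
heuristic is in print (searches logged in the seat's NOTES.md). The crux is the fixed-`δ` (slightly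
stronger) form of Rossman's open single-threshold problem (FOCS'10 §9); it is believed TRUE.

INDEX (all sorry-free except the single documented frontier near-miss in (z)):
* `singleThreshold_iff_lib` — the route's inlined statement is `Iff.rfl`-equal to the library form
  with `gnpProb`/`cliqueFn` (`RossmanMonotoneClique.lean`): provers may rewrite freely.
* (a) load-bearing hypotheses: `singleThreshold_false_without_basis` (drop `IsOver monotoneBasis`:
  one fan-in-`C(n,2)` table gate, size 1, error 0); `singleThreshold_false_without_accuracy` (drop
  `err ≤ δ`: the gate-free circuit `x_e`, size 0).
* (b) tightness in `δ`: `err_input_le_pc` (the size-0 circuit `x_e` errs w.p. ≤ `p_c + 1/k!`),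
  `witness_delta_le` (**any witness `(k,δ)` of the crux, at any exponent, has `δ ≤ 1/k!`**),
  `not_singleThresholdDeltaBeforeK` (the strengthening with `δ` uniform in `k` is FALSE).
* (c) tightness in `k`: `exists_monotone_cliqueCircuit` (exact DNF, size ≤ `C(n,k)(C(k,2)+1)`),
  `witness_exponent_lt` (**any witness `k` at exponent `c` has `c ≤ k+1`**),
  `not_singleThresholdKBeforeC` (one `k` for all `c` is FALSE).
* (d)+(e) `singleThreshold_iff_aas` — **the crux is EQUIVALENT to Rossman's a.a.s. single-threshold
  problem** in the `∀ c ∃ k` form (`AASLowerBoundAt c k`: `SolvesCliqueAAS k p_c C → ∀ᶠ n, n^c < |C n|`):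
  `⇒` (`aasLowerBoundAt_of_lowerBoundAt`) because an a.a.s. sequence is eventually `δ`-accurate;
  `⇐` (`exists_lowerBoundAt_of_aas`, `not_aas_of_not_singleThreshold`) by a diagonal splice: if no
  `δ` works, extract along `extraction_forall_of_frequently` bad circuits with error `≤ 1/(j+1)` and
  splice them with the exact DNF. So killing the crux = a NEGATIVE solution of the FOCS'10 §9
  problem by a fixed-exponent a.a.s. monotone detector for every `k`.
* (f) `not_lowerBound_of_subcritical`, `not_singleThresholdSubcritical` — the critical density is
  load-bearing: at any `q_n → 0` with `C(n,k) q_n^{C(k,2)} → 0` (e.g. Rossman 2008's `n^{-2/(k-2)}`)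
  the statement is FALSE for every `k` (size-0 circuit).
* (g) `gnpProb_forall_not_allOn` (independence over pairwise disjoint edge sets, inclusion–exclusion
  form: `Pr[no S_i fully present] = ∏ (1 - p^{|S_i|})`), `gnpProb_cliqueFree_le_pow`
  (`Pr[ω_k = 0] ≤ (1 - p^{C(k,2)})^{⌊n/k⌋}`, disjoint blocks), `not_singleThresholdDense` — at constant
  density `p = 1/2` the statement is FALSE for every `k` ("G has an edge", size ≤ C(n,2) < n²). With
  (f): any proof must use the CRITICAL scaling `p_c = n^{-2/(k-1)}` on both sides.
* (h) **where the content starts**: `gnpProb_and_eq_mul` (independence of events determined by `F`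
  and by `Fᶜ`, product weight split along `Equiv.piEquivPiSubtypeProd`), `eval_congr` +
  `length_inputList_le` (a fan-in-2 circuit reads ≤ `2·size+1` edges), `gnpProb_clique_touching_le`
  (`Pr[some k-clique touches F] ≤ |F|·C(n-2,k-2)·q^{C(k,2)}`), `err_ge_of_reads` (locality lower
  bound `Pr[C ≠ CLIQUE] ≥ min(Pr[ω=0], Pr[ω≥1] - τ) - τ`), and `lowerBoundAt_of_le_one`:
  **for `c ≤ 1` and EVERY `k ≥ 3`, `∃ δ > 0, LowerBoundAt c k δ`** — below `n²` gates the crux holds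
  by locality alone (no circuit structure used), so only `c ≥ 2` carries content; any refutation
  attempt must use ≥ `n²` gates, i.e. genuinely global computation (counting).
* **(i) `-- Targets` (cycle 2; skeleton `Lines/self-noise-closure.lean`, stubs `stub_structuralApprox`,
  `stub_plantedAcceptance`, `stub_selfNoiseLemma15`, `stub_fewCliqueMinterms`, `stub_positiveTrigger`)**.
  Cheap attacks on all five (degenerate instances, dropped hypotheses, small models, in-print
  counterexamples): stubs 1–4 SURVIVE and are TRUE in substance (1 = construction export of
  `exists_closedApprox`; 2 holds for ALL `f`, monotone or not, by the density identity
  `d(G ∪ K_A)/dG(n,p) = ω_k/𝔼ω_k` and Cauchy–Schwarz with `𝔼ω_k² = O_k(1)` at the threshold — the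
  `Monotone f` hypothesis is unnecessary (mutation finding for the prover); 3 by Janson/spread at ONE
  density, every proper subgraph of `K_k` being strictly supercritical at `p_c` (checked:
  `Δ/μ² ≤ n^{-j(k-j)/(k-1)}/η²`, also `k = 3`); 4 because Lemma 9 (`card_minterms_le_of_isClosedFn`) needs
  only `IsClosedFn` + subgraph-closed `K`, and the exponent `(k²+7)/(4(k-1)) = (k+1)/4 + 2/(k-1)` is
  right). Stub 5 is crux-equivalent given 1–4 (its hypotheses are satisfiable at large `n` iff small
  accurate circuits exist), so no independent kill exists; what IS provable and is proved here:
  `positiveTrigger_false_without_program` (+ `_forall`, `_forall_rpow`, `…'`) — **stub 5 with the program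
  `(gs, out, ap, WF, length ≤ n^c, gate equations, StarApproxInv)` replaced by its consequences for the
  output wire (`Monotone f̄`, `IsClosedFn f̄`) is FALSE for EVERY `k ≥ 3`, `a ≥ 1`, `η > 0` and every
  accuracy — constant `δ > 0` or `n^{-C}` for any real `C`** (witness `cliquePlusEdge` = "a `k`-clique and
  one more edge": rejects every isolated clique, errs only on bare cliques — probability
  `≤ (1-p_c)^{C(n,2)-C(k,2)} ≤ exp(-(n-1-k(k-1))/2)` — and is ⋆-closed because, by
  `isClosedFn_of_le_cliqueFn` from the planted Harris bound `le_gnpProb_cliqueFree_sup`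
  (`Pr[ω_k(G(n,p_c) ∪ h) = 0] ≥ e^{-2(1+k2^k)}` whenever `#supp h < k`), EVERY `f ≤ CLIQUE_k` is ⋆-closed
  at `(p_c, n^{-a}, smallI ∪ medJ)`). Consequences for the lead: (α) a proof of `stub_positiveTrigger`
  must use the wire structure AND the length bound (the witness is an exact monotone DNF of size
  `≤ n^{k+4}`); (β) ⋆-closedness of the OUTPUT wire is vacuous information (the output is `≈ CLIQUE_k`-like;
  any sub-clique function is closed for free) — the only non-vacuous closedness constraints sit on
  INTERNAL `∨̄`-wires `g` that are NOT `≤ CLIQUE_k` and are almost surely triggered by planting some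
  `h ∈ smallI ∪ medJ` with `g h = 0` (the closure then adds `Ind_h`; e.g. abundant-pattern detectors
  become `1`); (γ) the
  card's "first milestone" (the stub at polynomial accuracy `δ = n^{-C_k}`) is equally program-dependent
  (`positiveTrigger_false_forall_rpow`).
* (z) `frontier_lowerBoundAt_two` — `sorry`: the first contentful instance (c = 2) with the obstruction.

STATUS IN PRINT (quoted from the held text paper:doi-10-1109-focs-2010-26, p. 11, §9 "Future
Directions"): "One question raised by this work is whether the ω(n^{k/4}) average-case monotone lower
bound of Theorem 2 can be sharpened to hold for circuits solving the k-clique problem a.a.s. on G(n, p)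
for a single threshold function p(n). (This sharper average-case lower bound was shown for AC⁰
circuits in [18].)" By `singleThreshold_iff_aas` the crux is the unbounded-exponent (`∀ c ∃ k`) form
of exactly this question at `p = n^{-2/(k-1)}`. Oberwolfach Report 15/2024 (Risse, "Clique Is Hard on
Average for Sherali-Adams…", abstract): "Does k-clique require time n^{Ω(k)} on such graphs? … It is
unlikely that the hardness of such average-case questions can be based on worst-case hardness
assumptions … They are, in fact, being used as hardness assumptions themselves" — no fixed-exponent
average-case detector at the threshold is known or conjectured. First open exponent after (h): c = 2.
WHY IT RESISTS (cycle 2 formulation): `¬crux` = ONE exponent `c` with, for every `k`, size-`n^c` monotone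
circuits `δ`-accurate at the threshold i.o. — a fixed-exponent average-case `k`-clique detector for all
`k`. No such ALGORITHM is known even non-monotone and non-uniform: level-by-level enumeration of
`j`-cliques of `G(n,p_c)` costs their number `≍ n^{j(k-j)/(k-1)}`, maximal `≍ n^{k²/(4(k-1))} ≈ n^{k/4}` at
`j = k/2`, which is exactly Rossman's upper bound `n^{k/4+O(1)}` (Thm 3) and his AC⁰ lower bound; any
counterexample to the crux would beat the best known average-case clique algorithms at the threshold by
an unbounded polynomial factor, monotonically. Literature refresh (cycle 2, S2 sweep 2015–2026;
searchd/OpenAlex degraded): nearest new items are Błasiok–Meierhöfer 2025 (arXiv:2501.09545: monotone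
size `n^{Ω(δ²α)}` to reject `G(n, n^{-2/(α-1)})` while accepting every bare `β`-clique — the classical
two-distribution regime with ISOLATED positives; for PositiveTrigger it caps the isolated-acceptance
fraction of an accurate `f̄` only by `≈ Pr[ω_k ≥ 1] + δ`, no conflict) and Gamarnik–Mossel–Zadik 2023
(arXiv:2311.04204: sharp thresholds ⇒ bounded-depth average-case lower bounds; constant-`k` clique has a
coarse threshold and their sizes are `n^{O(k)}`-polynomial — different regime). No single-threshold
monotone result in print; the problem stands as posed in FOCS'10 §9.

NUMBERS (k; δ-ceiling 1/k! from (b); true Pr[ω_k ≥ 1] → 1 - e^{-1/k!}; log₁₀ of the in-tree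
explicit lower bound η_k = e^{-2k·2^k}/(2^k k!) on Pr[ω_k = 1] used in (h) — valid but absurdly weak,
a prover needing quantitative δ(k) should sharpen `eventually_le_gnpProb_cliqueCount_eq_one`;
Rossman's exponent k/4): 3: 1.7e-1, 1.5e-1, -22.5, 0.75 · 4: 4.2e-2, 4.1e-2, -58.2, 1.0 ·
5: 8.3e-3, 8.3e-3, -142.6, 1.25 · 6: 1.4e-3, 1.4e-3, -338, 1.5 · 8: 2.5e-5, 2.5e-5, -1786, 2.0 ·
10: 2.8e-7, 2.8e-7, -8904, 2.5.

ATTACKS ON PAPER (constructions of small accurate circuits; all fail with exponent Ω(k), recorded so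
nobody repeats them): (A) exact search inside a vertex window W, |W| = m: size ≈ C(m,k)·C(k,2), error
≈ Pr[ω_k ≥ 1]·(1 - (m/n)^k) — δ-accuracy forces m ≈ n, size n^k. (B) Rossman/Amano two-level scheme
(Thm 3, "C ∨ Threshold_m", p. 11 of the held text): n^{k/4+O(1)}, exponent grows with k. (C) counting
statistics (edge count, degrees, codegrees, K_j-counts for j < k): mean μ_j = C(n,j)p_c^{C(j,2)} =
Θ(n^{j(k-j)/(k-1)}) → ∞ with sd ≥ √μ_j ≫ C(k,j) = the planted clique's contribution, so every such
statistic has vanishing advantage (TRIAGE-r1-1 measured adv ∝ k²/√m for the edge count). (D) dense-spot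
detectors via common neighbourhoods of ℓ-sets: signal only for ℓ > (k-1)/2, cost n^{k/2}. (E) below n²
gates nothing works at all ((h), proved). No fixed-exponent candidate survives even heuristically.

CONSEQUENCE FOR PROVERS: the witnesses must be `k = k(c) ≥ c - 1` (Rossman Thm 3 suggests
`k ≥ 4c - O(1)`) and `δ = δ(k) ≤ 1/k!` (true scale `1 - e^{-1/k!} ∼ 1/k!`); every proof must use both
the `{∧₂,∨₂}` restriction and the accuracy hypothesis quantitatively at scale `1/k!`.
-/

namespace Summit.PneNP.PneNP.Cruxes.SingleThreshold.Disproof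

set_option linter.dupNamespace false

open Literature.Computability.Complexity Finset Filter Classical
open Summit.PneNP.PneNP.Theses.OneSlice (SingleThreshold)

noncomputable section

/-- The edge set of `K_n` (input positions). -/
abbrev Edges (n : ℕ) : Type := ((⊤ : SimpleGraph (Fin n)).edgeSet)

/-- The critical density `p = n^{-2/(k-1)}` of the crux. -/
def pc (n k : ℕ) : ℝ := (n : ℝ) ^ (-(2 : ℝ) / ((k : ℝ) - 1))

/-- The error probability of `C` for `k`-CLIQUE on `G(n, p_c)`, in library vocabulary. -/
def err (n k : ℕ) (C : Circuit (Edges n)) : ℝ :=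
  gnpProb n (pc n k) (univ.filter fun x => C.eval x ≠ cliqueFn n k x)

/-- The crux's matrix at exponent `c`, clique size `k`, accuracy `δ`: eventually in `n`, every
`δ`-accurate monotone circuit has more than `n^c` gates (library vocabulary `gnpProb`, `cliqueFn`);
the crux is `∀ c, ∃ k ≥ 3, ∃ δ > 0, LowerBoundAt c k δ` (`singleThreshold_iff_lib`). [folklore] -/
def LowerBoundAt (c k : ℕ) (δ : ℝ) : Prop :=
  ∀ᶠ n : ℕ in atTop, ∀ C : Circuit (Edges n), C.IsOver monotoneBasis → err n k C ≤ δ → n ^ c < C.size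

/-- The route's inlined statement IS the library statement, definitionally. [folklore] -/
theorem singleThreshold_iff_lib :
    SingleThreshold ↔ ∀ c : ℕ, ∃ k : ℕ, 3 ≤ k ∧ ∃ δ : ℝ, 0 < δ ∧ LowerBoundAt c k δ := Iff.rfl

/-! ## (a) Load-bearing hypotheses -/

/-- A one-gate "truth-table" circuit: a single gate of fan-in `|ι|` whose truth table is `f`. -/
def tableCircuit {ι : Type} [Fintype ι] (f : (ι → Bool) → Bool) : Circuit ι where
  gates := [⟨Fintype.card ι, fun v => f (fun i => v (Fintype.equivFin ι i)),
    fun a => Sum.inl ((Fintype.equivFin ι).symm a)⟩]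
  output := .inr 0
  wf := by
    intro j hj a m hm
    simp only [List.length_singleton, Nat.lt_one_iff] at hj
    subst hj
    simp at hm
  wf_output := by
    intro m hm
    cases hm
    simp

/-- The table circuit has one gate. [folklore] -/
theorem tableCircuit_size {ι : Type} [Fintype ι] (f : (ι → Bool) → Bool) :
    (tableCircuit f).size = 1 := rfl

/-- The table circuit computes its truth table. [folklore] -/
theorem tableCircuit_eval {ι : Type} [Fintype ι] (f : (ι → Bool) → Bool) (x : ι → Bool) :
    (tableCircuit f).eval x = f x := by
  simp [tableCircuit, Circuit.eval, Circuit.wireVals]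

/-- **The basis restriction is load-bearing.** The crux with `C.IsOver monotoneBasis` DROPPED
(gates of any truth table and fan-in) is FALSE: a single fan-in-`C(n,2)` gate computes `CLIQUE_k`
exactly (error `0`, size `1 = n^0`). [folklore] -/
theorem singleThreshold_false_without_basis :
    ¬ ∀ c : ℕ, ∃ k : ℕ, 3 ≤ k ∧ ∃ δ : ℝ, 0 < δ ∧ ∀ᶠ n : ℕ in atTop,
      ∀ C : Circuit (Edges n), err n k C ≤ δ → n ^ c < C.size := by
  intro h
  obtain ⟨k, -, δ, hδ, hev⟩ := h 0
  obtain ⟨n, hn⟩ := hev.exists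
  have h1 := hn (tableCircuit (cliqueFn n k)) ?_
  · simp [tableCircuit_size] at h1
  · have : (univ.filter fun x => (tableCircuit (cliqueFn n k)).eval x ≠ cliqueFn n k x) = ∅ := by
      simp [tableCircuit_eval]
    simp [err, this, gnpProb, hδ.le]

/-- An edge of `K_n`, `n ≥ 2`. -/
def e01 (n : ℕ) (hn : 2 ≤ n) : Edges n :=
  ⟨s(⟨0, by omega⟩, ⟨1, by omega⟩), by
    rw [SimpleGraph.mem_edgeSet, SimpleGraph.top_adj]
    simp⟩

/-- **The accuracy hypothesis is load-bearing.** The crux with `err ≤ δ` DROPPED is FALSE: the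
gate-free circuit `x_e` is monotone of size `0`. [folklore] -/
theorem singleThreshold_false_without_accuracy :
    ¬ ∀ c : ℕ, ∃ k : ℕ, 3 ≤ k ∧ ∃ δ : ℝ, 0 < δ ∧ ∀ᶠ n : ℕ in atTop,
      ∀ C : Circuit (Edges n), C.IsOver monotoneBasis → n ^ c < C.size := by
  intro h
  obtain ⟨k, -, δ, -, hev⟩ := h 0
  obtain ⟨n, hn, hn2⟩ := (hev.and (eventually_ge_atTop 2)).exists
  have h1 := hn (Circuit.input (e01 n hn2)) (fun g hg => by simp [Circuit.input] at hg)
  simp at h1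

/-! ## (b) Tightness in `δ`: every witness `(k, δ)` has `δ ≤ 1/k!` -/

/-- Union bound for `G(n,q)`-probabilities. [folklore] -/
theorem gnpProb_union_le {n : ℕ} {q : ℝ} (hq0 : 0 ≤ q) (hq1 : q ≤ 1)
    (A B : Finset (Edges n → Bool)) :
    gnpProb n q (A ∪ B) ≤ gnpProb n q A + gnpProb n q B := by
  have h := Finset.sum_union_inter (s₁ := A) (s₂ := B) (f := gnpWeight n q)
  have h0 : 0 ≤ gnpProb n q (A ∩ B) := gnpProb_nonneg hq0 hq1 _
  unfold gnpProb at *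
  linarith

/-- `Pr[x_e = 1] = q`. [folklore] -/
theorem gnpProb_coord_true {n : ℕ} (q : ℝ) (e : Edges n) :
    gnpProb n q (univ.filter fun x : Edges n → Bool => x e = true) = q := by
  have h := sum_gnpWeight_filter_forall (n := n) q {e}
  simp only [mem_singleton, forall_eq, card_singleton, pow_one] at h
  exact h

/-- The error of the gate-free circuit `x_e` at density `q`: at most
`Pr[x_e = 1] + Pr[ω_k ≥ 1] ≤ q + C(n,k) q^{C(k,2)}` (first moment). [folklore] -/
theorem err_input_le {n k : ℕ} (e : Edges n) {q : ℝ} (hq0 : 0 ≤ q) (hq1 : q ≤ 1) :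
    gnpProb n q (univ.filter fun x => (Circuit.input e).eval x ≠ cliqueFn n k x)
      ≤ q + (n.choose k : ℝ) * q ^ (k.choose 2) := by
  have hsub : (univ.filter fun x : Edges n → Bool => (Circuit.input e).eval x ≠ cliqueFn n k x) ⊆
      (univ.filter fun x : Edges n → Bool => x e = true) ∪
        (univ.filter fun x => cliqueFn n k x = true) := by
    intro x hx
    simp only [mem_filter, mem_univ, true_and, Circuit.eval_input] at hx
    simp only [mem_union, mem_filter, mem_univ, true_and]
    revert hx
    cases x e <;> cases cliqueFn n k x <;> simp
  calc gnpProb n q (univ.filter fun x => (Circuit.input e).eval x ≠ cliqueFn n k x)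
      ≤ gnpProb n q ((univ.filter fun x : Edges n → Bool => x e = true) ∪
          (univ.filter fun x => cliqueFn n k x = true)) := gnpProb_mono hq0 hq1 hsub
    _ ≤ gnpProb n q (univ.filter fun x : Edges n → Bool => x e = true) +
          gnpProb n q (univ.filter fun x => cliqueFn n k x = true) := gnpProb_union_le hq0 hq1 _ _
    _ ≤ q + (n.choose k : ℝ) * q ^ (k.choose 2) := by
        rw [gnpProb_coord_true]
        exact add_le_add le_rfl (gnpProb_clique_le hq0 hq1 k)

/-- `0 ≤ p_c`. [folklore] -/
theorem pc_nonneg (n k : ℕ) : 0 ≤ pc n k := Real.rpow_nonneg (Nat.cast_nonneg n) _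

/-- `p_c ≤ 1` for `n ≥ 1`, `k ≥ 2`. [folklore] -/
theorem pc_le_one {n k : ℕ} (hn : 1 ≤ n) (hk : 2 ≤ k) : pc n k ≤ 1 := by
  unfold pc
  apply Real.rpow_le_one_of_one_le_of_nonpos (by exact_mod_cast hn)
  have hk' : (2 : ℝ) ≤ k := by exact_mod_cast hk
  exact div_nonpos_of_nonpos_of_nonneg (by norm_num) (by linarith)

/-- At the critical density the first moment is `C(n,k) · p_c^{C(k,2)} = C(n,k) n^{-k} ≤ 1/k!`.
[folklore] -/
theorem firstMoment_pc_le {n k : ℕ} (hn : 1 ≤ n) (hk : 2 ≤ k) :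
    (n.choose k : ℝ) * pc n k ^ (k.choose 2) ≤ 1 / (k.factorial : ℝ) := by
  have hn0 : (0 : ℝ) < n := by exact_mod_cast hn
  have hk1 : (k : ℝ) - 1 ≠ 0 := by
    have : (2 : ℝ) ≤ k := by exact_mod_cast hk
    linarith
  have hpow : pc n k ^ (k.choose 2) = ((n : ℝ) ^ k)⁻¹ := by
    unfold pc
    rw [← Real.rpow_natCast, ← Real.rpow_mul hn0.le, Nat.cast_choose_two]
    have : -2 / ((k : ℝ) - 1) * ((k : ℝ) * ((k : ℝ) - 1) / 2) = -(k : ℝ) := by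
      field_simp
    rw [this, Real.rpow_neg hn0.le, Real.rpow_natCast]
  rw [hpow]
  have hc : (n.choose k : ℝ) ≤ ((n : ℝ) ^ k) / (k.factorial : ℝ) := Nat.choose_le_pow_div k n
  have hnk : (0 : ℝ) < (n : ℝ) ^ k := pow_pos hn0 k
  calc (n.choose k : ℝ) * ((n : ℝ) ^ k)⁻¹ ≤ ((n : ℝ) ^ k / (k.factorial : ℝ)) * ((n : ℝ) ^ k)⁻¹ :=
        mul_le_mul_of_nonneg_right hc (inv_nonneg.2 hnk.le)
    _ = 1 / (k.factorial : ℝ) := by field_simp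

/-- **Tightness in `δ`.** The size-`0` monotone circuit `x_e` has error at most
`p_c + 1/k!` on `G(n, p_c)`. [folklore] -/
theorem err_input_le_pc {n k : ℕ} (hn : 1 ≤ n) (hk : 2 ≤ k) (e : Edges n) :
    err n k (Circuit.input e) ≤ pc n k + 1 / (k.factorial : ℝ) :=
  (err_input_le e (pc_nonneg n k) (pc_le_one hn hk)).trans
    (add_le_add le_rfl (firstMoment_pc_le hn hk))

/-- `p_c = n^{-2/(k-1)} → 0` for `k ≥ 2`. [folklore] -/
theorem tendsto_pc {k : ℕ} (hk : 2 ≤ k) : Tendsto (fun n => pc n k) atTop (nhds 0) := by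
  have hpos : 0 < (2 : ℝ) / ((k : ℝ) - 1) := by
    have hk' : (2 : ℝ) ≤ k := by exact_mod_cast hk
    exact div_pos two_pos (by linarith)
  have h1 := (tendsto_rpow_neg_atTop hpos).comp tendsto_natCast_atTop_atTop
  refine h1.congr fun n => ?_
  simp only [Function.comp_apply, pc, neg_div]

/-- **Every witness has `δ ≤ 1/k!`.** If `(k, δ)` witnesses the crux at some exponent `c`
(indeed at any `c`), then `δ ≤ 1/k!`: otherwise the size-`0` circuit `x_e` is `δ`-accurate for
all large `n`. So the `∃ δ` of the crux necessarily shrinks like `1/k!` (the true scale is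
`Pr[ω_k ≥ 1] → 1 - e^{-1/k!}`). [folklore] -/
theorem witness_delta_le {c k : ℕ} {δ : ℝ} (hk : 2 ≤ k) (h : LowerBoundAt c k δ) :
    δ ≤ 1 / (k.factorial : ℝ) := by
  by_contra hlt
  push Not at hlt
  have hε : 0 < δ - 1 / (k.factorial : ℝ) := by linarith
  have hev := (tendsto_pc hk).eventually (eventually_le_nhds hε)
  obtain ⟨n, hn, hpc, hn2⟩ := (h.and (hev.and (eventually_ge_atTop 2))).exists
  have herr : err n k (Circuit.input (e01 n hn2)) ≤ δ := by
    have := err_input_le_pc (by omega) hk (e01 n hn2)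
    linarith
  have := hn (Circuit.input (e01 n hn2)) (fun g hg => by simp [Circuit.input] at hg) herr
  simp at this

/-- **Natural strengthening no. 1 — `δ` chosen BEFORE `k` (uniformly in `k`) — is FALSE**: a `δ`
uniform in `k` is beaten by `x_e` once `1/k! < δ`. [folklore] -/
theorem not_singleThresholdDeltaBeforeK :
    ¬ ∀ c : ℕ, ∃ δ : ℝ, 0 < δ ∧ ∀ k : ℕ, 3 ≤ k → LowerBoundAt c k δ := by
  intro h
  obtain ⟨δ, hδ, H⟩ := h 0
  -- a clique size with `1/k! < δ`
  obtain ⟨k₀, hk₀⟩ := exists_nat_gt (1 / δ)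
  set k := max 3 k₀ with hk
  have hk3 : 3 ≤ k := le_max_left _ _
  have hkδ : 1 / (k.factorial : ℝ) < δ := by
    have h1 : (k₀ : ℝ) ≤ k := by exact_mod_cast le_max_right 3 k₀
    have h2 : (k : ℝ) ≤ k.factorial := by exact_mod_cast Nat.self_le_factorial k
    have h3 : 1 / δ < (k.factorial : ℝ) := by linarith
    have h4 : 0 < (k.factorial : ℝ) := by positivity
    rw [div_lt_iff₀ h4]
    rw [div_lt_iff₀ hδ] at h3
    linarith
  exact absurd (witness_delta_le (by omega) (H k hk3)) (not_le.2 hkδ)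

/-! ## (c) Tightness in `k`: every witness `k` at exponent `c` has `c ≤ k + 1` -/

/-- **The exact monotone clique circuit with its size.** For `2 ≤ k ≤ n`, the OR over all
`k`-sets `S` of the AND of the `C(k,2)` edges inside `S` is a `{∧₂, ∨₂}`-circuit of size at most
`C(n,k) · (C(k,2) + 1)` computing `CLIQUE_k` exactly (the library's
`exists_monotone_computes_cliqueFn_holds`, with the size bookkeeping kept). [folklore] -/
theorem exists_monotone_cliqueCircuit {n k : ℕ} (h2 : 2 ≤ k) (hkn : k ≤ n) :
    ∃ C : Circuit (Edges n), C.IsOver monotoneBasis ∧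
      C.size ≤ n.choose k * (k.choose 2 + 1) ∧ ∀ x, C.eval x = cliqueFn n k x := by
  classical
  set T : Finset (Finset (Fin n)) := powersetCard k univ with hT
  let E : Finset (Fin n) → List (Edges n) := fun S => (univ.filter fun e => IsLive S e).toList
  have hElen : ∀ S ∈ T, (E S).length = k.choose 2 := by
    intro S hS
    have hScard : #S = k := (mem_powersetCard.1 hS).2
    simp only [E, Finset.length_toList]
    rw [← hScard, ← card_filter_cliqueVec S]
    congr 1
    ext e
    simp only [mem_filter, mem_univ, true_and, cliqueVec_eq_true_iff]
  have hEne : ∀ S ∈ T, E S ≠ [] := by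
    intro S hS
    have := hElen S hS
    intro hnil
    rw [hnil, List.length_nil] at this
    have : 1 ≤ k.choose 2 := Nat.choose_pos h2
    omega
  have hTcard : #T = n.choose k := by rw [hT, card_powersetCard, card_univ, Fintype.card_fin]
  have hTne : T.Nonempty := powersetCard_nonempty.2 (by simpa using hkn)
  -- stage 1: all the ANDs in parallel
  have h1 : CktSize monotoneBasis
      (fun (x : Edges n → Bool) (S : T) => (E S).all fun e => x e) (∑ S : T, (E S).length) :=
    CktSize.pi fun S => cktSize_all (E S) (hEne S S.2)
  -- stage 2: the OR of the results
  have hUne : (univ : Finset T).toList ≠ [] := by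
    obtain ⟨S, hS⟩ := hTne
    intro hnil
    have := Finset.mem_toList.2 (mem_univ (⟨S, hS⟩ : T))
    rw [hnil] at this
    simp at this
  have h2 := h1.comp (cktSize_any (ι := T) (univ : Finset T).toList hUne)
  obtain ⟨C, hCB, hsize, hCev⟩ := h2.toCircuit
  refine ⟨C, hCB, ?_, fun x => ?_⟩
  · -- size bookkeeping
    refine hsize.trans (le_of_eq ?_)
    have hsum : ∑ S : T, (E S).length = n.choose k * k.choose 2 := by
      rw [Finset.sum_coe_sort T (fun S => (E S).length), Finset.sum_congr rfl hElen, sum_const,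
        hTcard, smul_eq_mul]
    rw [hsum, Finset.length_toList, card_univ, Fintype.card_coe, hTcard]
    ring
  · rw [hCev]
    apply Bool.eq_iff_iff.2
    rw [cliqueFn_eq_true_iff_exists, List.any_eq_true]
    constructor
    · rintro ⟨S, -, hS⟩
      rw [List.all_eq_true] at hS
      refine ⟨S, (mem_powersetCard.1 S.2).2, fun e he => hS e ?_⟩
      exact Finset.mem_toList.2 (mem_filter.2 ⟨mem_univ _, he⟩)
    · rintro ⟨S, hS, hx⟩
      have hST : S ∈ T := mem_powersetCard.2 ⟨subset_univ _, hS⟩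
      refine ⟨⟨S, hST⟩, Finset.mem_toList.2 (mem_univ _), ?_⟩
      rw [List.all_eq_true]
      intro e he
      exact hx e (mem_filter.1 (Finset.mem_toList.1 he)).2

/-- The exact circuit has size `≤ n^{k+2}` for `2 ≤ k ≤ n`. [folklore] -/
theorem choose_mul_le_pow {n k : ℕ} (h2 : 2 ≤ k) (hkn : k ≤ n) :
    n.choose k * (k.choose 2 + 1) ≤ n ^ (k + 2) := by
  have h1 : n.choose k ≤ n ^ k := Nat.choose_le_pow n k
  have h2' : k.choose 2 + 1 ≤ n ^ 2 := by
    have ha : k.choose 2 ≤ k * (k - 1) := by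
      rw [Nat.choose_two_right]; exact Nat.div_le_self _ _
    have hb : k * (k - 1) = k * k - k := Nat.mul_sub_one k k
    have hc : k ≤ k * k := Nat.le_mul_self k
    have hd : k * k ≤ n * n := Nat.mul_le_mul hkn hkn
    have he : n ^ 2 = n * n := sq n
    omega
  calc n.choose k * (k.choose 2 + 1) ≤ n ^ k * n ^ 2 := Nat.mul_le_mul h1 h2'
    _ = n ^ (k + 2) := (pow_add n k 2).symm

/-- **Every witness has `c ≤ k + 1`.** If `(k, δ)` with `δ ≥ 0` witnesses the crux at exponent
`c`, then `c < k + 2`: otherwise the exact DNF circuit (error `0`, size `≤ n^{k+2} ≤ n^c`)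
violates it for every `n ≥ k`. So `k(c) → ∞` is forced — the crux cannot be met with a bounded
clique size (Rossman's Thm 3 would even force `k ≥ 4c - O(1)`, not formalised). [folklore] -/
theorem witness_exponent_lt {c k : ℕ} {δ : ℝ} (hk : 2 ≤ k) (hδ : 0 ≤ δ) (h : LowerBoundAt c k δ) :
    c < k + 2 := by
  by_contra hc
  push Not at hc
  obtain ⟨n, hn, hnk⟩ := (h.and (eventually_ge_atTop (max k 2))).exists
  have hkn : k ≤ n := le_of_max_le_left hnk
  have hn2 : 2 ≤ n := le_of_max_le_right hnk
  obtain ⟨C, hCB, hsize, hCev⟩ := exists_monotone_cliqueCircuit hk hkn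
  have herr : err n k C ≤ δ := by
    have : (univ.filter fun x => C.eval x ≠ cliqueFn n k x) = ∅ := by
      simp [hCev]
    simp [err, this, gnpProb, hδ]
  have h1 := hn C hCB herr
  have h2 : C.size ≤ n ^ c :=
    (hsize.trans (choose_mul_le_pow hk hkn)).trans (Nat.pow_le_pow_right (by omega) hc)
  omega

/-- **Natural strengthening no. 2 — ONE clique size `k` for every exponent `c` — is FALSE** (exact
DNF circuit at `c = k + 2`). [folklore] -/
theorem not_singleThresholdKBeforeC :
    ¬ ∃ k : ℕ, 3 ≤ k ∧ ∃ δ : ℝ, 0 < δ ∧ ∀ c : ℕ, LowerBoundAt c k δ := by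
  rintro ⟨k, hk3, δ, hδ, H⟩
  have := witness_exponent_lt (c := k + 2) (by omega) hδ.le (H (k + 2))
  omega

/-! ## (d) Relation to Rossman's a.a.s. single-threshold problem -/

/-- The a.a.s. (error `→ 0`) single-threshold lower-bound MATRIX at exponent `c` and clique size `k`
over `{∧₂, ∨₂}`: every eventually-monotone sequence of circuits that solves `k`-CLIQUE a.a.s. on
`G(n, p_c)` has eventually more than `n^c` gates (a definition, not a claim; the question whether
`∀ c, ∃ k ≥ 3, AASLowerBoundAt c k` holds is the one posed in Rossman 2010, §9, p. 11 of the held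
text, and is equivalent to the crux by `singleThreshold_iff_aas`). [folklore] -/
def AASLowerBoundAt (c k : ℕ) : Prop :=
  ∀ C : (n : ℕ) → Circuit (Edges n), (∀ᶠ n : ℕ in atTop, (C n).IsOver monotoneBasis) →
    SolvesCliqueAAS k (fun n => pc n k) C → ∀ᶠ n : ℕ in atTop, n ^ c < (C n).size

/-- Fixed `δ` implies a.a.s.: an a.a.s.-correct sequence is eventually `δ`-accurate. [folklore] -/
theorem aasLowerBoundAt_of_lowerBoundAt {c k : ℕ} {δ : ℝ} (hδ : 0 < δ) (h : LowerBoundAt c k δ) :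
    AASLowerBoundAt c k := by
  intro C hC hsolve
  have hsmall : ∀ᶠ n : ℕ in atTop, err n k (C n) ≤ δ :=
    (hsolve.eventually (eventually_le_nhds hδ)).mono fun n hn => hn
  filter_upwards [h, hC, hsmall] with n hn hCn hsm
  exact hn (C n) hCn hsm

/-- The crux implies Rossman's a.a.s. single-threshold lower bound (unbounded-exponent form).
[folklore] -/
theorem singleThreshold_implies_aas :
    SingleThreshold → ∀ c : ℕ, ∃ k : ℕ, 3 ≤ k ∧ AASLowerBoundAt c k := by
  intro h c
  obtain ⟨k, hk3, δ, hδ, hev⟩ := (singleThreshold_iff_lib.1 h) c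
  exact ⟨k, hk3, aasLowerBoundAt_of_lowerBoundAt hδ hev⟩

/-- A default monotone-or-not circuit at every `n`: the exact DNF when `2 ≤ k ≤ n`, else a constant.
[folklore] -/
def fallback (n k : ℕ) : Circuit (Edges n) :=
  if h : 2 ≤ k ∧ k ≤ n then (exists_monotone_cliqueCircuit h.1 h.2).choose else Circuit.const _ false

/-- The fallback circuit is monotone and exact once `2 ≤ k ≤ n`. [folklore] -/
theorem fallback_spec {n k : ℕ} (h2 : 2 ≤ k) (hkn : k ≤ n) :
    (fallback n k).IsOver monotoneBasis ∧ ∀ x, (fallback n k).eval x = cliqueFn n k x := by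
  have h : 2 ≤ k ∧ k ≤ n := ⟨h2, hkn⟩
  simp only [fallback, h, and_self, ↓reduceDIte]
  exact ⟨(exists_monotone_cliqueCircuit h2 hkn).choose_spec.1,
    (exists_monotone_cliqueCircuit h2 hkn).choose_spec.2.2⟩

/-- An exact circuit has error `0`. [folklore] -/
theorem err_eq_zero_of_exact {n k : ℕ} {C : Circuit (Edges n)} (h : ∀ x, C.eval x = cliqueFn n k x) :
    err n k C = 0 := by
  have : (univ.filter fun x => C.eval x ≠ cliqueFn n k x) = ∅ := by simp [h]
  simp [err, this, gnpProb]

/-- `0 ≤ err`. [folklore] -/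
theorem err_nonneg {n k : ℕ} (hn : 1 ≤ n) (hk : 2 ≤ k) (C : Circuit (Edges n)) : 0 ≤ err n k C :=
  gnpProb_nonneg (pc_nonneg n k) (pc_le_one hn hk) _

/-- **The converse: the a.a.s. form implies the crux** (diagonal/splicing argument). If for some
exponent `c` and clique size `k` NO `δ > 0` works, then for every `j` there are, infinitely often in
`n`, monotone circuits of size `≤ n^c` with error `≤ 1/(j+1)`; extracting a strictly increasing
subsequence and splicing these circuits with the exact DNF elsewhere yields ONE a.a.s.-correct
sequence of size `≤ n^c` infinitely often, contradicting the a.a.s. lower bound. Hence the crux is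
EQUIVALENT to Rossman's single-threshold problem in the `∀ c ∃ k` a.a.s. form. [folklore] -/
theorem exists_lowerBoundAt_of_aas {c k : ℕ} (hk3 : 3 ≤ k) (H : AASLowerBoundAt c k) :
    ∃ δ : ℝ, 0 < δ ∧ LowerBoundAt c k δ := by
  by_contra hno
  simp only [LowerBoundAt] at hno
  push Not at hno
  -- `hno : ∀ δ, 0 < δ → ¬ ∀ᶠ n, ∀ C mono, err ≤ δ → n^c < size`
  have hfreq : ∀ j : ℕ, ∃ᶠ n in atTop, ∃ C : Circuit (Edges n),
      C.IsOver monotoneBasis ∧ err n k C ≤ 1 / ((j : ℝ) + 1) ∧ C.size ≤ n ^ c := by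
    intro j
    have hj : (0 : ℝ) < 1 / ((j : ℝ) + 1) := by positivity
    exact hno _ hj
  obtain ⟨φ, hφ, hbad⟩ := extraction_forall_of_frequently hfreq
  -- the spliced sequence
  let Q : ℕ → ℕ → Prop := fun j n => ∃ C : Circuit (Edges n),
    C.IsOver monotoneBasis ∧ err n k C ≤ 1 / ((j : ℝ) + 1) ∧ C.size ≤ n ^ c
  have hQ : ∀ j, Q j (φ j) := hbad
  let S : (n : ℕ) → Circuit (Edges n) := fun n =>
    if h : ∃ j, φ j = n ∧ Q j n then h.choose_spec.2.choose else fallback n k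
  -- on the subsequence, `S` is the bad circuit
  have hS_on : ∀ j, (S (φ j)).IsOver monotoneBasis ∧
      err (φ j) k (S (φ j)) ≤ 1 / ((j : ℝ) + 1) ∧ (S (φ j)).size ≤ (φ j) ^ c := by
    intro j
    have hex : ∃ i, φ i = φ j ∧ Q i (φ j) := ⟨j, rfl, hQ j⟩
    have hdef : S (φ j) = hex.choose_spec.2.choose := by simp only [S, dif_pos hex]
    have hi : hex.choose = j := hφ.injective hex.choose_spec.1
    have key : ∀ i (hq : Q i (φ j)), i = j → (hq.choose.IsOver monotoneBasis ∧
        err (φ j) k hq.choose ≤ 1 / ((j : ℝ) + 1) ∧ hq.choose.size ≤ (φ j) ^ c) := by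
      rintro i hq rfl
      exact hq.choose_spec
    rw [hdef]
    exact key _ hex.choose_spec.2 hi
  -- off the subsequence, `S` is the fallback
  have hS_off : ∀ n, (¬ ∃ j, φ j = n) → S n = fallback n k := by
    intro n hn
    have : ¬ ∃ j, φ j = n ∧ Q j n := fun ⟨j, hj, _⟩ => hn ⟨j, hj⟩
    simp only [S, dif_neg this]
  have hk2 : 2 ≤ k := by omega
  -- `S` is eventually monotone
  have hmono : ∀ᶠ n in atTop, (S n).IsOver monotoneBasis := by
    filter_upwards [eventually_ge_atTop k] with n hn
    by_cases h : ∃ j, φ j = n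
    · obtain ⟨j, rfl⟩ := h
      exact (hS_on j).1
    · rw [hS_off n h]
      exact (fallback_spec hk2 hn).1
  -- `S` is a.a.s. correct
  have haas : SolvesCliqueAAS k (fun n => pc n k) S := by
    rw [SolvesCliqueAAS, Metric.tendsto_atTop]
    intro ε hε
    obtain ⟨J, hJ⟩ := exists_nat_gt (1 / ε)
    refine ⟨max k (φ J), fun n hn => ?_⟩
    have hnk : k ≤ n := le_of_max_le_left hn
    have hn1 : 1 ≤ n := by omega
    rw [Real.dist_eq, sub_zero]
    change |err n k (S n)| < ε
    rw [abs_of_nonneg (err_nonneg hn1 hk2 _)]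
    by_cases h : ∃ j, φ j = n
    · obtain ⟨j, rfl⟩ := h
      have hjJ : J ≤ j := hφ.le_iff_le.1 (le_of_max_le_right hn)
      have h1 : err (φ j) k (S (φ j)) ≤ 1 / ((j : ℝ) + 1) := (hS_on j).2.1
      have h2 : 1 / ((j : ℝ) + 1) < ε := by
        have hjJ' : (J : ℝ) ≤ j := by exact_mod_cast hjJ
        rw [div_lt_iff₀ (by positivity)]
        rw [div_lt_iff₀ hε] at hJ
        nlinarith
      linarith
    · rw [hS_off n h, err_eq_zero_of_exact (fallback_spec hk2 hnk).2]
      exact hε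
  -- but `S` is small infinitely often
  have hlarge := H S hmono haas
  obtain ⟨N, hN⟩ := eventually_atTop.1 hlarge
  have hφN : N ≤ φ N := hφ.id_le N
  have h1 := hN (φ N) hφN
  have h2 := (hS_on N).2.2
  omega

/-- **Killing the crux kills Rossman's a.a.s. problem**: `¬ crux → ¬ (∀ c ∃ k ≥ 3, AASLowerBoundAt c k)`
(contrapositive of `exists_lowerBoundAt_of_aas`). With `singleThreshold_implies_aas` the crux is
EQUIVALENT to the a.a.s. single-threshold lower bound in the unbounded-exponent form. [folklore] -/
theorem not_aas_of_not_singleThreshold (h : ¬ SingleThreshold) :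
    ¬ ∀ c : ℕ, ∃ k : ℕ, 3 ≤ k ∧ AASLowerBoundAt c k := by
  intro hA
  apply h
  rw [singleThreshold_iff_lib]
  intro c
  obtain ⟨k, hk3, H⟩ := hA c
  exact ⟨k, hk3, exists_lowerBoundAt_of_aas hk3 H⟩

/-- **The crux is exactly Rossman's a.a.s. single-threshold problem (unbounded-exponent form).**
[folklore] -/
theorem singleThreshold_iff_aas :
    SingleThreshold ↔ ∀ c : ℕ, ∃ k : ℕ, 3 ≤ k ∧ AASLowerBoundAt c k :=
  ⟨singleThreshold_implies_aas, fun hA => by_contra fun h => not_aas_of_not_singleThreshold h hA⟩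

/-! ## (f) The critical density is load-bearing (subcritical side) -/

/-- Error of `C` for `k`-CLIQUE at a general density `q`. [folklore] -/
def errAt (n k : ℕ) (q : ℝ) (C : Circuit (Edges n)) : ℝ :=
  gnpProb n q (univ.filter fun x => C.eval x ≠ cliqueFn n k x)

/-- **Subcritical densities kill the lower bound.** If `q_n → 0` and the first moment
`C(n,k) q_n^{C(k,2)} → 0`, then at density `q_n` NO `δ > 0` and exponent `c` give the lower
bound: the size-0 circuit `x_e` is eventually `δ`-accurate. So any proof of the crux must use that
`p_c = n^{-2/(k-1)}` keeps `E[ω_k]` bounded AWAY FROM `0`. [folklore] -/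
theorem not_lowerBound_of_subcritical {k : ℕ} {q : ℕ → ℝ} (hq : ∀ n, 0 ≤ q n ∧ q n ≤ 1)
    (h0 : Tendsto q atTop (nhds 0))
    (h1 : Tendsto (fun n => (n.choose k : ℝ) * q n ^ (k.choose 2)) atTop (nhds 0))
    {δ : ℝ} (hδ : 0 < δ) (c : ℕ) :
    ¬ ∀ᶠ n : ℕ in atTop, ∀ C : Circuit (Edges n), C.IsOver monotoneBasis →
      errAt n k (q n) C ≤ δ → n ^ c < C.size := by
  intro h
  have hsum : Tendsto (fun n => q n + (n.choose k : ℝ) * q n ^ (k.choose 2)) atTop (nhds 0) := by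
    simpa using h0.add h1
  obtain ⟨n, hn, hle, hn2⟩ :=
    (h.and ((hsum.eventually (eventually_le_nhds hδ)).and (eventually_ge_atTop 2))).exists
  have herr : errAt n k (q n) (Circuit.input (e01 n hn2)) ≤ δ :=
    (err_input_le (e01 n hn2) (hq n).1 (hq n).2).trans hle
  have := hn (Circuit.input (e01 n hn2)) (fun g hg => by simp [Circuit.input] at hg) herr
  simp at this

/-- **Below the threshold the statement is FALSE** (the crux transplanted to Rossman's 2008
subcritical density `n^{-2/(k-2)}`; every `k ≥ 3`): cliques vanish a.a.s. (first moment,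
`tendsto_choose_mul_rpow_subcritical`) and `x_e` is `δ`-accurate. [folklore] -/
theorem not_singleThresholdSubcritical :
    ¬ ∀ c : ℕ, ∃ k : ℕ, 3 ≤ k ∧ ∃ δ : ℝ, 0 < δ ∧ ∀ᶠ n : ℕ in atTop,
      ∀ C : Circuit (Edges n), C.IsOver monotoneBasis →
        errAt n k ((n : ℝ) ^ (-(2 / ((k : ℝ) - 2)))) C ≤ δ → n ^ c < C.size := by
  intro h
  obtain ⟨k, hk3, δ, hδ, hev⟩ := h 0
  have hk2 : (0 : ℝ) < 2 / ((k : ℝ) - 2) := by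
    have : (3 : ℝ) ≤ k := by exact_mod_cast hk3
    exact div_pos two_pos (by linarith)
  refine not_lowerBound_of_subcritical (k := k) (q := fun n => (n : ℝ) ^ (-(2 / ((k : ℝ) - 2))))
    (fun n => ⟨Real.rpow_nonneg (Nat.cast_nonneg n) _, ?_⟩) ?_
    (tendsto_choose_mul_rpow_subcritical hk3) hδ 0 hev
  · rcases Nat.eq_zero_or_pos n with rfl | hn
    · simp [Real.zero_rpow (neg_ne_zero.2 hk2.ne')]
    · exact Real.rpow_le_one_of_one_le_of_nonpos (by exact_mod_cast hn) (neg_nonpos.2 hk2.le)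
  · exact ((tendsto_rpow_neg_atTop hk2).comp tendsto_natCast_atTop_atTop).congr fun n => rfl

/-! ## (g) The critical density is load-bearing (supercritical / dense side) -/

/-! ### (g.1) Independence over disjoint edge sets -/

/-- **Independence across pairwise disjoint edge sets** (inclusion–exclusion form): for pairwise
disjoint edge sets `S i`, `Pr[no S_i is fully present in G(n,p)] = ∏ᵢ (1 - p^{|S_i|})`. [folklore] -/
theorem gnpProb_forall_not_allOn {ι : Type*} {n : ℕ} (T : Finset ι) (S : ι → Finset (Edges n))
    (hS : (T : Set ι).PairwiseDisjoint S) (p : ℝ) :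
    gnpProb n p (univ.filter fun x : Edges n → Bool => ∀ i ∈ T, ¬ ∀ e ∈ S i, x e = true) =
      ∏ i ∈ T, (1 - p ^ #(S i)) := by
  classical
  -- pointwise inclusion–exclusion
  have hpt : ∀ x : Edges n → Bool,
      (if (∀ i ∈ T, ¬ ∀ e ∈ S i, x e = true) then (1 : ℝ) else 0) =
        ∑ J ∈ T.powerset, (-1 : ℝ) ^ #J * (if (∀ i ∈ J, ∀ e ∈ S i, x e = true) then 1 else 0) := by
    intro x
    have h1 : (if (∀ i ∈ T, ¬ ∀ e ∈ S i, x e = true) then (1 : ℝ) else 0) =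
        ∏ i ∈ T, (-(if (∀ e ∈ S i, x e = true) then (1 : ℝ) else 0) + 1) := by
      rw [← Finset.prod_boole]
      refine Finset.prod_congr rfl fun i _ => ?_
      split_ifs <;> norm_num
    rw [h1, Finset.prod_add]
    refine Finset.sum_congr rfl fun J hJ => ?_
    rw [prod_const_one, mul_one, Finset.prod_neg, Finset.prod_boole]
  -- integrate
  rw [gnpProb_filter]
  have h2 : ∀ x : Edges n → Bool, (if (∀ i ∈ T, ¬ ∀ e ∈ S i, x e = true) then gnpWeight n p x else 0)
      = ∑ J ∈ T.powerset, (-1 : ℝ) ^ #J *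
          (if (∀ i ∈ J, ∀ e ∈ S i, x e = true) then gnpWeight n p x else 0) := by
    intro x
    have := congrArg (fun r => r * gnpWeight n p x) (hpt x)
    simp only [ite_mul, one_mul, zero_mul, Finset.sum_mul] at this
    rw [this]
    refine Finset.sum_congr rfl fun J _ => ?_
    split_ifs <;> ring
  simp_rw [h2]
  rw [Finset.sum_comm]
  -- each inner sum is a marginal
  have h3 : ∀ J ∈ T.powerset,
      ∑ x : Edges n → Bool, (-1 : ℝ) ^ #J *
          (if (∀ i ∈ J, ∀ e ∈ S i, x e = true) then gnpWeight n p x else 0) =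
        ∏ i ∈ J, (-(p ^ #(S i))) := by
    intro J hJ
    have hJT : J ⊆ T := Finset.mem_powerset.1 hJ
    rw [← Finset.mul_sum, ← Finset.sum_filter]
    have hset : (univ.filter fun x : Edges n → Bool => ∀ i ∈ J, ∀ e ∈ S i, x e = true) =
        (univ.filter fun x : Edges n → Bool => ∀ e ∈ J.biUnion S, x e = true) := by
      ext x
      simp only [mem_filter, mem_univ, true_and, mem_biUnion, forall_exists_index, and_imp]
      constructor
      · intro h e i hi he
        exact h i hi e he
      · intro h i hi e he
        exact h e i hi he
    rw [hset, sum_gnpWeight_filter_forall, Finset.card_biUnion (hS.subset hJT),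
      Finset.prod_neg, ← Finset.prod_pow_eq_pow_sum]
  rw [Finset.sum_congr rfl h3]
  -- and back to a product
  have h4 := Finset.prod_add (fun i => -(p ^ #(S i))) (fun _ => (1 : ℝ)) T
  simp only [prod_const_one, mul_one] at h4
  rw [← h4]
  exact Finset.prod_congr rfl fun i _ => by ring

/-! ### (g.2) Vertex-disjoint blocks of `k` consecutive vertices -/

/-- The `i`-th block of `k` consecutive vertices `{ik, …, ik + k - 1}` of `Fin n`, `i < n / k`,
as an embedding. [folklore] -/
def blockEmb (n k : ℕ) (i : Fin (n / k)) : Fin k ↪ Fin n :=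
  ⟨fun j => ⟨(i : ℕ) * k + j, by
      have hi : ((i : ℕ) + 1) * k ≤ n / k * k := Nat.mul_le_mul_right k i.2
      have hn : n / k * k ≤ n := Nat.div_mul_le_self n k
      have hj := j.2
      have h3 : ((i : ℕ) + 1) * k = (i : ℕ) * k + k := by ring
      omega⟩,
    fun a b hab => by
      simp only [Fin.mk.injEq] at hab
      exact Fin.ext (by omega)⟩

/-- The `i`-th block as a vertex set. [folklore] -/
def block (n k : ℕ) (i : Fin (n / k)) : Finset (Fin n) := univ.map (blockEmb n k i)

/-- Block bookkeeping. [folklore] -/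
theorem card_block (n k : ℕ) (i : Fin (n / k)) : #(block n k i) = k := by
  rw [block, card_map, card_univ, Fintype.card_fin]

/-- Block bookkeeping. [folklore] -/
theorem mem_block_iff {n k : ℕ} (i : Fin (n / k)) (v : Fin n) :
    v ∈ block n k i ↔ ∃ j : Fin k, (i : ℕ) * k + j = v := by
  simp only [block, Finset.mem_map, mem_univ, true_and]
  constructor
  · rintro ⟨j, hj⟩
    refine ⟨j, ?_⟩
    rw [← hj]
    rfl
  · rintro ⟨j, hj⟩
    exact ⟨j, Fin.ext hj⟩

/-- Block bookkeeping. [folklore] -/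
theorem block_disjoint {n k : ℕ} (hk : 0 < k) {i j : Fin (n / k)} (hij : i ≠ j) :
    Disjoint (block n k i) (block n k j) := by
  rw [Finset.disjoint_left]
  intro v hvi hvj
  rw [mem_block_iff] at hvi hvj
  obtain ⟨a, ha⟩ := hvi
  obtain ⟨b, hb⟩ := hvj
  have h1 : ((i : ℕ) * k + a) / k = i := by
    rw [Nat.add_comm, Nat.add_mul_div_right _ _ hk, Nat.div_eq_of_lt a.2, zero_add]
  have h2 : ((j : ℕ) * k + b) / k = j := by
    rw [Nat.add_comm, Nat.add_mul_div_right _ _ hk, Nat.div_eq_of_lt b.2, zero_add]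
  have : (i : ℕ) = j := by rw [← h1, ← h2, ha, hb]
  exact hij (Fin.ext this)

/-- The edges inside the `i`-th block. [folklore] -/
def blockEdges (n k : ℕ) (i : Fin (n / k)) : Finset (Edges n) :=
  univ.filter fun e => cliqueVec (block n k i) e = true

/-- Block bookkeeping. [folklore] -/
theorem card_blockEdges (n k : ℕ) (i : Fin (n / k)) : #(blockEdges n k i) = k.choose 2 := by
  rw [blockEdges, card_filter_cliqueVec, card_block]

/-- Block bookkeeping. [folklore] -/
theorem blockEdges_pairwiseDisjoint {n k : ℕ} (hk : 0 < k) :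
    ((univ : Finset (Fin (n / k))) : Set (Fin (n / k))).PairwiseDisjoint (blockEdges n k) := by
  intro i _ j _ hij
  simp only [Function.onFun]
  rw [Finset.disjoint_left]
  intro e hei hej
  simp only [blockEdges, mem_filter, mem_univ, true_and, cliqueVec, decide_eq_true_eq] at hei hej
  obtain ⟨e, he⟩ := e
  induction e using Sym2.ind with
  | h u v =>
    have hu1 : u ∈ block n k i := hei u (Sym2.mem_mk_left u v)
    have hu2 : u ∈ block n k j := hej u (Sym2.mem_mk_left u v)
    exact Finset.disjoint_left.1 (block_disjoint hk hij) hu1 hu2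

/-- **Disjoint blocks**: `Pr[ω_k(G(n,p)) = 0] ≤ (1 - p^{C(k,2)})^{⌊n/k⌋}`. [folklore] -/
theorem gnpProb_cliqueFree_le_pow {n k : ℕ} (hk : 0 < k) {p : ℝ} (hp0 : 0 ≤ p) (hp1 : p ≤ 1) :
    gnpProb n p (univ.filter fun x => cliqueFn n k x = false) ≤ (1 - p ^ k.choose 2) ^ (n / k) := by
  have hsub : (univ.filter fun x : Edges n → Bool => cliqueFn n k x = false) ⊆
      univ.filter fun x => ∀ i ∈ (univ : Finset (Fin (n / k))), ¬ ∀ e ∈ blockEdges n k i, x e = true := by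
    intro x hx
    simp only [mem_filter, mem_univ, true_and] at hx
    refine mem_filter.2 ⟨mem_univ _, fun i _ hall => ?_⟩
    have : cliqueFn n k x = true := by
      rw [cliqueFn_eq_true_iff_exists]
      refine ⟨block n k i, card_block n k i, fun e he => hall e ?_⟩
      simp only [blockEdges, mem_filter, mem_univ, true_and]
      exact (cliqueVec_eq_true_iff _ _).2 he
    rw [hx] at this
    exact absurd this (by decide)
  calc gnpProb n p (univ.filter fun x => cliqueFn n k x = false)
      ≤ gnpProb n p (univ.filter fun x =>
          ∀ i ∈ (univ : Finset (Fin (n / k))), ¬ ∀ e ∈ blockEdges n k i, x e = true) :=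
        gnpProb_mono hp0 hp1 hsub
    _ = ∏ i ∈ (univ : Finset (Fin (n / k))), (1 - p ^ #(blockEdges n k i)) := by
        have h := gnpProb_forall_not_allOn (univ : Finset (Fin (n / k))) (blockEdges n k)
          (blockEdges_pairwiseDisjoint hk) p
        convert h using 3
    _ = (1 - p ^ k.choose 2) ^ (n / k) := by
        simp only [card_blockEdges, prod_const, card_univ, Fintype.card_fin]

/-! ### (g.3) The dense regime `p = 1/2` -/

/-- **The OR of all edges** ("`G` has an edge"): a `{∧₂,∨₂}`-circuit of size `≤ C(n,2)`. [folklore] -/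
theorem exists_orAll_circuit {n : ℕ} (hn : 2 ≤ n) :
    ∃ C : Circuit (Edges n), C.IsOver monotoneBasis ∧ C.size ≤ n.choose 2 ∧
      ∀ x, C.eval x = decide (∃ e, x e = true) := by
  classical
  have hne : (univ : Finset (Edges n)).toList ≠ [] := by
    intro hnil
    have h01 : s((⟨0, by omega⟩ : Fin n), ⟨1, by omega⟩) ∈ (⊤ : SimpleGraph (Fin n)).edgeSet := by
      rw [SimpleGraph.mem_edgeSet, SimpleGraph.top_adj]; simp
    have := Finset.mem_toList.2 (mem_univ (⟨_, h01⟩ : Edges n))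
    rw [hnil] at this
    simp at this
  obtain ⟨C, hCB, hsize, hCev⟩ := (cktSize_any (univ : Finset (Edges n)).toList hne).toCircuit
  refine ⟨C, hCB, ?_, fun x => ?_⟩
  · rw [Finset.length_toList, card_univ, card_edgeSet_top_fin] at hsize
    exact hsize
  · rw [hCev]
    apply Bool.eq_iff_iff.2
    simp [List.any_eq_true]

/-- `Pr[G(n,p) has no edge] = (1-p)^{C(n,2)}`. [folklore] -/
theorem gnpProb_noEdge (n : ℕ) (p : ℝ) :
    gnpProb n p (univ.filter fun x : Edges n → Bool => ¬ ∃ e, x e = true) = (1 - p) ^ n.choose 2 := by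
  have hset : (univ.filter fun x : Edges n → Bool => ¬ ∃ e, x e = true) = {fun _ => false} := by
    ext x
    simp only [mem_filter, mem_univ, true_and, mem_singleton, not_exists, Bool.not_eq_true]
    constructor
    · intro h; funext e; exact h e
    · intro h e; rw [h]
  rw [hset, gnpProb, sum_singleton, gnpWeight, edgeCount]
  simp

/-- **At constant density the statement is FALSE** (supercritical side; every `k ≥ 1`):
on `G(n, 1/2)` the size-`≤ C(n,2)` circuit "`G` has an edge" errs w.p.
`≤ 2^{-C(n,2)} + (1 - 2^{-C(k,2)})^{⌊n/k⌋} → 0`, so no `δ > 0` enforces more than `n²` gates.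
Together with the subcritical side: any proof of the crux must use the CRITICAL scaling of `p`.
[folklore] -/
theorem not_singleThresholdDense :
    ¬ ∀ c : ℕ, ∃ k : ℕ, 3 ≤ k ∧ ∃ δ : ℝ, 0 < δ ∧ ∀ᶠ n : ℕ in atTop,
      ∀ C : Circuit (Edges n), C.IsOver monotoneBasis →
        errAt n k (1 / 2) C ≤ δ → n ^ c < C.size := by
  intro h
  obtain ⟨k, hk3, δ, hδ, hev⟩ := h 2
  have hk : 0 < k := by omega
  -- both error terms tend to `0`
  have hA : Tendsto (fun n : ℕ => (1 - (1 / 2 : ℝ)) ^ n.choose 2) atTop (nhds 0) := by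
    have h1 : Tendsto (fun m : ℕ => (1 - (1 / 2 : ℝ)) ^ m) atTop (nhds 0) :=
      tendsto_pow_atTop_nhds_zero_of_lt_one (by norm_num) (by norm_num)
    refine h1.comp ?_
    refine tendsto_atTop_atTop.2 fun b => ⟨b + 2, fun n hn => ?_⟩
    calc b ≤ n - 1 := by omega
      _ ≤ n.choose 2 := by
          rw [Nat.choose_two_right]
          rcases n with _ | n
          · simp
          · simp only [Nat.succ_sub_one]
            calc n = n * 2 / 2 := by omega
              _ ≤ (n + 1) * n / 2 := Nat.div_le_div_right (by nlinarith)
  have hB : Tendsto (fun n : ℕ => (1 - (1 / 2 : ℝ) ^ k.choose 2) ^ (n / k)) atTop (nhds 0) := by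
    have hq1 : (1 - (1 / 2 : ℝ) ^ k.choose 2) < 1 := by
      have : (0 : ℝ) < (1 / 2 : ℝ) ^ k.choose 2 := by positivity
      linarith
    have hq0 : 0 ≤ (1 - (1 / 2 : ℝ) ^ k.choose 2) := by
      have : (1 / 2 : ℝ) ^ k.choose 2 ≤ 1 := pow_le_one₀ (by norm_num) (by norm_num)
      linarith
    have h1 := tendsto_pow_atTop_nhds_zero_of_lt_one hq0 hq1
    refine h1.comp ?_
    exact tendsto_atTop_atTop.2 fun b => ⟨b * k, fun n hn => (Nat.le_div_iff_mul_le hk).2 hn⟩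
  have hsum : Tendsto (fun n : ℕ => (1 - (1 / 2 : ℝ)) ^ n.choose 2 +
      (1 - (1 / 2 : ℝ) ^ k.choose 2) ^ (n / k)) atTop (nhds 0) := by
    simpa using hA.add hB
  obtain ⟨n, hn, hle, hn2⟩ :=
    (hev.and ((hsum.eventually (eventually_le_nhds hδ)).and (eventually_ge_atTop 2))).exists
  obtain ⟨C, hCB, hsize, hCev⟩ := exists_orAll_circuit hn2
  -- the error of `C`
  have herr : errAt n k (1 / 2) C ≤ δ := by
    have hsub : (univ.filter fun x : Edges n → Bool => C.eval x ≠ cliqueFn n k x) ⊆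
        (univ.filter fun x : Edges n → Bool => ¬ ∃ e, x e = true) ∪
          (univ.filter fun x => cliqueFn n k x = false) := by
      intro x hx
      simp only [mem_filter, mem_univ, true_and, hCev] at hx
      simp only [mem_union, mem_filter, mem_univ, true_and]
      by_cases hex : ∃ e, x e = true
      · right
        rw [decide_eq_true hex] at hx
        revert hx
        cases cliqueFn n k x <;> simp
      · exact Or.inl hex
    have h12 : (0 : ℝ) ≤ 1 / 2 := by norm_num
    have h12' : (1 / 2 : ℝ) ≤ 1 := by norm_num
    calc errAt n k (1 / 2) C ≤ gnpProb n (1 / 2) ((univ.filter fun x : Edges n → Bool => ¬ ∃ e, x e = true) ∪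
          (univ.filter fun x => cliqueFn n k x = false)) := gnpProb_mono h12 h12' hsub
      _ ≤ gnpProb n (1 / 2) (univ.filter fun x : Edges n → Bool => ¬ ∃ e, x e = true) +
          gnpProb n (1 / 2) (univ.filter fun x => cliqueFn n k x = false) := by
          have hh := Finset.sum_union_inter
            (s₁ := (univ.filter fun x : Edges n → Bool => ¬ ∃ e, x e = true))
            (s₂ := (univ.filter fun x => cliqueFn n k x = false)) (f := gnpWeight n (1 / 2))
          have h0 : 0 ≤ gnpProb n (1 / 2) ((univ.filter fun x : Edges n → Bool => ¬ ∃ e, x e = true) ∩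
            (univ.filter fun x => cliqueFn n k x = false)) := gnpProb_nonneg h12 h12' _
          unfold gnpProb at *
          linarith
      _ ≤ (1 - (1 / 2 : ℝ)) ^ n.choose 2 + (1 - (1 / 2 : ℝ) ^ k.choose 2) ^ (n / k) := by
          rw [gnpProb_noEdge]
          exact add_le_add le_rfl (gnpProb_cliqueFree_le_pow hk h12 h12')
      _ ≤ δ := hle
  have h1 := hn C hCB herr
  have h2 : n.choose 2 < n ^ 2 := by
    have ha : n.choose 2 ≤ n * (n - 1) := by
      rw [Nat.choose_two_right]; exact Nat.div_le_self _ _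
    have hb : n * (n - 1) = n * n - n := Nat.mul_sub_one n n
    have hc : n ≤ n * n := Nat.le_mul_self n
    have hd : n ^ 2 = n * n := sq n
    omega
  omega

/-! ## (h) Locality: below `n²` gates the crux is TRUE for every `k` (where the content starts) -/

/-! ### (h.1) Independence of events determined by disjoint coordinate sets -/

/-- **Independence in `G(n,q)`**: an event determined by the edges in `F` and an event determined
by the edges outside `F` are independent (product weight splits along
`Equiv.piEquivPiSubtypeProd`). [folklore] -/
theorem gnpProb_and_eq_mul {n : ℕ} (F : Finset (Edges n)) (P Q : (Edges n → Bool) → Prop)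
    [DecidablePred P] [DecidablePred Q]
    (hP : ∀ x y : Edges n → Bool, (∀ e ∈ F, x e = y e) → (P x ↔ P y))
    (hQ : ∀ x y : Edges n → Bool, (∀ e ∉ F, x e = y e) → (Q x ↔ Q y)) (q : ℝ) :
    gnpProb n q (univ.filter fun x => P x ∧ Q x) =
      gnpProb n q (univ.filter P) * gnpProb n q (univ.filter Q) := by
  classical
  -- coordinate weights
  let φ : Bool → ℝ := fun b => if b = true then q else 1 - q
  have hφsum : ∑ b : Bool, φ b = 1 := by simp [φ]
  have hw : ∀ x : Edges n → Bool, gnpWeight n q x = ∏ e, φ (x e) := fun x => gnpWeight_eq_prod q x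
  -- split the coordinates by membership in `F`
  set p : Edges n → Prop := fun e => e ∈ F with hp
  clear_value p
  set σ := Equiv.piEquivPiSubtypeProd p (fun _ : Edges n => Bool) with hσ
  let a₀ : {e // p e} → Bool := fun _ => false
  let b₀ : {e // ¬ p e} → Bool := fun _ => false
  -- the events seen on each side
  have hPsplit : ∀ (a : {e // p e} → Bool) (b : {e // ¬ p e} → Bool),
      P (σ.symm (a, b)) ↔ P (σ.symm (a, b₀)) := by
    intro a b
    refine hP _ _ fun e he => ?_
    have he' : p e := by rw [hp]; exact he
    simp [hσ, Equiv.piEquivPiSubtypeProd, he']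
  have hQsplit : ∀ (a : {e // p e} → Bool) (b : {e // ¬ p e} → Bool),
      Q (σ.symm (a, b)) ↔ Q (σ.symm (a₀, b)) := by
    intro a b
    refine hQ _ _ fun e he => ?_
    have he' : ¬ p e := by rw [hp]; exact he
    simp [hσ, Equiv.piEquivPiSubtypeProd, he']
  -- the weight factorises
  let wA : ({e // p e} → Bool) → ℝ := fun a => ∏ j, φ (a j)
  let wB : ({e // ¬ p e} → Bool) → ℝ := fun b => ∏ j, φ (b j)
  have hfac : ∀ a b, gnpWeight n q (σ.symm (a, b)) = wA a * wB b := by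
    intro a b
    simp only [wA, wB]
    rw [hw, ← Fintype.prod_subtype_mul_prod_subtype p (fun e => φ (σ.symm (a, b) e))]
    congr 1
    · exact Fintype.prod_congr _ _ fun j => by simp [hσ, Equiv.piEquivPiSubtypeProd, j.2]
    · exact Fintype.prod_congr _ _ fun j => by simp [hσ, Equiv.piEquivPiSubtypeProd, j.2]
  have hA1 : ∑ a, wA a = 1 := by
    simp only [wA]
    rw [ProductWeights.sum_prod_weight (ι := {e // p e}) (fun _ => φ)]
    simp only [hφsum, Finset.prod_const_one]
  have hB1 : ∑ b, wB b = 1 := by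
    simp only [wB]
    rw [ProductWeights.sum_prod_weight (ι := {e // ¬ p e}) (fun _ => φ)]
    simp only [hφsum, Finset.prod_const_one]
  -- general reindexing of an event's probability
  have key : ∀ (R : (Edges n → Bool) → Prop) [DecidablePred R],
      gnpProb n q (univ.filter R) =
        ∑ a, ∑ b, (if R (σ.symm (a, b)) then wA a * wB b else 0) := by
    intro R _
    rw [gnpProb_filter, ← Equiv.sum_comp σ.symm, Fintype.sum_prod_type]
    refine Finset.sum_congr rfl fun a _ => Finset.sum_congr rfl fun b _ => ?_
    rw [hfac]
  rw [key, key, key]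
  -- evaluate the three sums
  have e1 : ∑ a, ∑ b, (if (P (σ.symm (a, b)) ∧ Q (σ.symm (a, b))) then wA a * wB b else 0) =
      (∑ a, if P (σ.symm (a, b₀)) then wA a else 0) * ∑ b, (if Q (σ.symm (a₀, b)) then wB b else 0) := by
    rw [Finset.sum_mul_sum]
    refine Finset.sum_congr rfl fun a _ => Finset.sum_congr rfl fun b _ => ?_
    have h1 := hPsplit a b
    have h2 := hQsplit a b
    by_cases hp : P (σ.symm (a, b₀)) <;> by_cases hq : Q (σ.symm (a₀, b))
    · rw [if_pos ⟨h1.2 hp, h2.2 hq⟩, if_pos hp, if_pos hq]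
    · rw [if_neg (fun h => hq (h2.1 h.2)), if_pos hp, if_neg hq, mul_zero]
    · rw [if_neg (fun h => hp (h1.1 h.1)), if_neg hp, zero_mul]
    · rw [if_neg (fun h => hp (h1.1 h.1)), if_neg hp, zero_mul]
  have e2 : ∑ a, ∑ b, (if P (σ.symm (a, b)) then wA a * wB b else 0) =
      ∑ a, if P (σ.symm (a, b₀)) then wA a else 0 := by
    refine Finset.sum_congr rfl fun a _ => ?_
    by_cases hp : P (σ.symm (a, b₀))
    · rw [if_pos hp]
      calc ∑ b, (if P (σ.symm (a, b)) then wA a * wB b else 0) = ∑ b, wA a * wB b :=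
            Finset.sum_congr rfl fun b _ => if_pos ((hPsplit a b).2 hp)
        _ = wA a := by rw [← Finset.mul_sum, hB1, mul_one]
    · rw [if_neg hp]
      exact Finset.sum_eq_zero fun b _ => if_neg (fun h => hp ((hPsplit a b).1 h))
  have e3 : ∑ a, ∑ b, (if Q (σ.symm (a, b)) then wA a * wB b else 0) =
      ∑ b, (if Q (σ.symm (a₀, b)) then wB b else 0) := by
    rw [Finset.sum_comm]
    calc ∑ b, ∑ a, (if Q (σ.symm (a, b)) then wA a * wB b else 0)
        = ∑ b, (if Q (σ.symm (a₀, b)) then wB b else 0) * ∑ a, wA a := by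
          refine Finset.sum_congr rfl fun b _ => ?_
          by_cases hq : Q (σ.symm (a₀, b))
          · rw [if_pos hq, Finset.mul_sum]
            exact Finset.sum_congr rfl fun a _ => by rw [if_pos ((hQsplit a b).2 hq)]; ring
          · rw [if_neg hq, zero_mul]
            exact Finset.sum_eq_zero fun a _ => if_neg (fun h => hq ((hQsplit a b).1 h))
      _ = ∑ b, (if Q (σ.symm (a₀, b)) then wB b else 0) := by
          refine Finset.sum_congr rfl fun b _ => ?_
          rw [hA1, mul_one]
  rw [e1, e2, e3]

/-! ### (h.2) Locality of circuit evaluation: a circuit reads at most `2·size + 1` variables -/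

/-- The input variables read by a gate. [folklore] -/
def gateInputs {ι : Type*} (g : Gate ι) : List ι :=
  (List.finRange g.arity).filterMap fun a => (g.args a).getLeft?

theorem mem_gateInputs {ι : Type*} {g : Gate ι} {a : Fin g.arity} {i : ι}
    (h : g.args a = Sum.inl i) : i ∈ gateInputs g := by
  simp only [gateInputs, List.mem_filterMap, List.mem_finRange, true_and]
  exact ⟨a, by rw [h]; rfl⟩

theorem length_gateInputs_le {ι : Type*} (g : Gate ι) : (gateInputs g).length ≤ g.arity := by
  unfold gateInputs
  calc _ ≤ (List.finRange g.arity).length := List.length_filterMap_le _ _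
    _ = g.arity := List.length_finRange

/-- All input variables a circuit reads (gate arguments and, possibly, the output wire). [folklore] -/
def inputList {ι : Type*} (C : Circuit ι) : List ι :=
  C.gates.flatMap gateInputs ++ C.output.getLeft?.toList

/-- Gate values depend only on the variables the gates read. [folklore] -/
theorem wireVals_congr {ι : Type*} (C : Circuit ι) {x y : ι → Bool}
    (h : ∀ g ∈ C.gates, ∀ i ∈ gateInputs g, x i = y i) : C.wireVals x = C.wireVals y := by
  unfold Circuit.wireVals
  suffices ∀ (gs : List (Gate ι)) (acc : List Bool), (∀ g ∈ gs, ∀ i ∈ gateInputs g, x i = y i) →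
      gs.foldl (fun vals g => vals ++ [g.op fun a => match g.args a with
        | .inl i => x i | .inr m => vals.getD m false]) acc =
      gs.foldl (fun vals g => vals ++ [g.op fun a => match g.args a with
        | .inl i => y i | .inr m => vals.getD m false]) acc from this C.gates [] h
  intro gs
  induction gs with
  | nil => intro acc _; rfl
  | cons g gs ih =>
    intro acc hgs
    simp only [List.foldl_cons]
    have hg : (g.op fun a => match g.args a with | .inl i => x i | .inr m => acc.getD m false) =
        (g.op fun a => match g.args a with | .inl i => y i | .inr m => acc.getD m false) := by
      congr 1
      funext a
      rcases hga : g.args a with i | m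
      · exact hgs g List.mem_cons_self i (mem_gateInputs hga)
      · rfl
    rw [hg]
    exact ih _ fun g' hg' => hgs g' (List.mem_cons_of_mem _ hg')

/-- **Locality**: the value of a circuit depends only on the variables it reads. [folklore] -/
theorem eval_congr {ι : Type*} (C : Circuit ι) {x y : ι → Bool}
    (h : ∀ i ∈ inputList C, x i = y i) : C.eval x = C.eval y := by
  have hg : ∀ g ∈ C.gates, ∀ i ∈ gateInputs g, x i = y i := fun g hg i hi =>
    h i (List.mem_append_left _ (List.mem_flatMap.2 ⟨g, hg, hi⟩))
  have hw := wireVals_congr C hg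
  unfold Circuit.eval
  rcases hout : C.output with i | m
  · apply h
    simp [inputList, hout]
  · rw [hw]

/-- Over a fan-in-`2` basis a circuit reads at most `2·size + 1` variables. [folklore] -/
theorem length_inputList_le {ι : Type*} (C : Circuit ι) (hC : ∀ g ∈ C.gates, g.arity ≤ 2) :
    (inputList C).length ≤ 2 * C.size + 1 := by
  have h1 : ∀ gs : List (Gate ι), (∀ g ∈ gs, g.arity ≤ 2) →
      (gs.flatMap gateInputs).length ≤ 2 * gs.length := by
    intro gs hgs
    induction gs with
    | nil => simp
    | cons g gs ih =>
      simp only [List.flatMap_cons, List.length_append, List.length_cons]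
      have h₁ := length_gateInputs_le g
      have h₂ := hgs g List.mem_cons_self
      have h₃ := ih fun g' hg' => hgs g' (List.mem_cons_of_mem _ hg')
      omega
  have h2 : C.output.getLeft?.toList.length ≤ 1 := by
    cases C.output <;> simp
  unfold inputList Circuit.size
  rw [List.length_append]
  have := h1 C.gates hC
  omega

/-- Gates over `{∧₂, ∨₂}` have fan-in `2`. [folklore] -/
theorem arity_le_two_of_isOver {ι : Type*} {C : Circuit ι} (hC : C.IsOver monotoneBasis) :
    ∀ g ∈ C.gates, g.arity ≤ 2 := by
  intro g hg
  have h := hC g hg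
  simp only [monotoneBasis, Set.mem_insert_iff, Set.mem_singleton_iff] at h
  rcases h with h | h
  · have := congrArg Sigma.fst h
    simp only [Gate.fn, GateFn.and] at this
    omega
  · have := congrArg Sigma.fst h
    simp only [Gate.fn, GateFn.or] at this
    omega

/-! ### (h.3) Cliques touching a small edge set are unlikely -/

/-- "Some `k`-clique of `x` has an edge in `F`". [folklore] -/
def Touch (n k : ℕ) (F : Finset (Edges n)) (x : Edges n → Bool) : Prop :=
  ∃ A ∈ powersetCard k (univ : Finset (Fin n)),
    (∀ e, cliqueVec A e = true → x e = true) ∧ ∃ e ∈ F, cliqueVec A e = true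


/-- `Pr[some k-set A with K_A ⊆ G(n,q) has an edge of K_A in F] ≤ |F| · C(n-2, k-2) · q^{C(k,2)}`.
[folklore] -/
theorem gnpProb_clique_touching_le {n k : ℕ} (F : Finset (Edges n)) {q : ℝ} (hq0 : 0 ≤ q)
    (hq1 : q ≤ 1) :
    gnpProb n q (univ.filter fun x => Touch n k F x)
      ≤ #F * ((n - 2).choose (k - 2) : ℝ) * q ^ (k.choose 2) := by
  classical
  set T : Finset (Finset (Fin n)) :=
    (powersetCard k univ).filter fun A => ∃ e ∈ F, cliqueVec A e = true with hT
  have hunion := Rossman2010L23.gnpProb_filter_le_sum (n := n) hq0 hq1 T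
    (fun x => Touch n k F x)
    (fun A x => ∀ e, cliqueVec A e = true → x e = true)
    (fun x hx => by
      obtain ⟨A, hA, hsub, htouch⟩ := hx
      exact ⟨A, mem_filter.2 ⟨hA, htouch⟩, hsub⟩)
  refine hunion.trans ?_
  have hterm : ∀ A ∈ T, gnpProb n q (univ.filter fun x => ∀ e, cliqueVec A e = true → x e = true) =
      q ^ (k.choose 2) := by
    intro A hA
    rw [Rossman2010L23.gnpProb_sub, (mem_powersetCard.1 (mem_filter.1 hA).1).2]
  rw [sum_congr rfl hterm, sum_const, nsmul_eq_mul]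
  refine mul_le_mul_of_nonneg_right ?_ (pow_nonneg hq0 _)
  -- `#T ≤ |F| · C(n-2, k-2)`
  have hTsub : T ⊆ F.biUnion fun e => (powersetCard k univ).filter fun A => endpts e ⊆ A := by
    intro A hA
    rw [mem_filter] at hA
    obtain ⟨e, he, hce⟩ := hA.2
    exact mem_biUnion.2 ⟨e, he, mem_filter.2 ⟨hA.1, (cliqueVec_eq_true_iff_endpts A e).1 hce⟩⟩
  calc (#T : ℝ) ≤ #(F.biUnion fun e => (powersetCard k univ).filter fun A => endpts e ⊆ A) := by
        exact_mod_cast card_le_card hTsub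
    _ ≤ ∑ e ∈ F, (#((powersetCard k univ).filter fun A => endpts e ⊆ A) : ℝ) := by
        exact_mod_cast card_biUnion_le
    _ ≤ ∑ e ∈ F, ((n - 2).choose (k - 2) : ℝ) := by
        refine sum_le_sum fun e _ => ?_
        have h := card_filter_supset_le (k := k) (endpts e)
        rw [card_endpts] at h
        exact_mod_cast h
    _ = #F * ((n - 2).choose (k - 2) : ℝ) := by rw [sum_const, nsmul_eq_mul]

/-! ### (h.4) The locality lower bound on the error of a circuit reading few edges -/

/-- Switch off the edges in `F`. [folklore] -/
def zeroOn {n : ℕ} (F : Finset (Edges n)) (x : Edges n → Bool) : Edges n → Bool :=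
  fun e => if e ∈ F then false else x e

theorem zeroOn_le {n : ℕ} (F : Finset (Edges n)) (x : Edges n → Bool) : zeroOn F x ≤ x := by
  intro e
  unfold zeroOn
  split_ifs
  · exact Bool.false_le _
  · exact le_rfl

theorem zeroOn_congr_off {n : ℕ} {F : Finset (Edges n)} {x y : Edges n → Bool}
    (h : ∀ e ∉ F, x e = y e) : zeroOn F x = zeroOn F y := by
  funext e
  unfold zeroOn
  split_ifs with he
  · rfl
  · exact h e he

/-- If `x` has a `k`-clique and no `k`-clique of `x` touches `F`, then `x` minus `F` still has a
`k`-clique. [folklore] -/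
theorem cliqueFn_zeroOn_eq_true {n k : ℕ} (F : Finset (Edges n)) (x : Edges n → Bool)
    (hx : cliqueFn n k x = true) (hT : ¬ Touch n k F x) : cliqueFn n k (zeroOn F x) = true := by
  rw [cliqueFn_eq_true_iff_exists] at hx ⊢
  obtain ⟨S, hS, hlive⟩ := hx
  refine ⟨S, hS, fun e he => ?_⟩
  have hxe := hlive e he
  unfold zeroOn
  split_ifs with heF
  · exfalso
    apply hT
    refine ⟨S, mem_powersetCard.2 ⟨subset_univ _, hS⟩, fun e' he' => hlive e' ?_, e, heF, ?_⟩
    · exact (cliqueVec_eq_true_iff S e').1 he'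
    · exact (cliqueVec_eq_true_iff S e).2 he
  · exact hxe

/-- `CLIQUE(x ∖ F) ≠ CLIQUE(x)` forces a clique touching `F`. [folklore] -/
theorem touch_of_ne {n k : ℕ} (F : Finset (Edges n)) (x : Edges n → Bool)
    (h : cliqueFn n k (zeroOn F x) ≠ cliqueFn n k x) : Touch n k F x := by
  by_contra hT
  have hle : cliqueFn n k (zeroOn F x) ≤ cliqueFn n k x := cliqueFn_monotone_holds n k (zeroOn_le F x)
  cases hx : cliqueFn n k x
  · rw [hx] at hle h
    exact h (le_antisymm hle (Bool.false_le _))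
  · exact h (by rw [cliqueFn_zeroOn_eq_true F x hx hT, hx])

/-! ### (h.4b) Probabilities of Boolean events, by name (keeps unification cheap) -/

/-- `Pr[f(G) = b]`. [folklore] -/
def pEq (n : ℕ) (q : ℝ) (f : (Edges n → Bool) → Bool) (b : Bool) : ℝ :=
  gnpProb n q (univ.filter fun x => f x = b)

/-- `Pr[f(G) ≠ g(G)]`. [folklore] -/
def pNe (n : ℕ) (q : ℝ) (f g : (Edges n → Bool) → Bool) : ℝ :=
  gnpProb n q (univ.filter fun x => f x ≠ g x)

/-- `Pr[some k-clique of G touches F]`. [folklore] -/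
def pTouch (n k : ℕ) (q : ℝ) (F : Finset (Edges n)) : ℝ :=
  gnpProb n q (univ.filter fun x => Touch n k F x)

theorem pEq_nonneg {n : ℕ} {q : ℝ} (hq0 : 0 ≤ q) (hq1 : q ≤ 1) (f : (Edges n → Bool) → Bool) (b : Bool) :
    0 ≤ pEq n q f b := gnpProb_nonneg hq0 hq1 _

/-- Complementary Boolean events have total probability `1`. [folklore] -/
theorem pEq_true_add_false {n : ℕ} (q : ℝ) (f : (Edges n → Bool) → Bool) :
    pEq n q f true + pEq n q f false = 1 := by
  have h : (univ.filter fun x : Edges n → Bool => f x = false) = (univ.filter fun x => f x = true)ᶜ := by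
    ext x
    simp
  unfold pEq
  rw [h, gnpProb_compl]
  ring

/-- Triangle inequality `Pr[f ≠ g] ≤ Pr[f ≠ h] + Pr[g ≠ h]`. [folklore] -/
theorem pNe_triangle {n : ℕ} {q : ℝ} (hq0 : 0 ≤ q) (hq1 : q ≤ 1) (f g h : (Edges n → Bool) → Bool) :
    pNe n q f g ≤ pNe n q f h + pNe n q g h := by
  unfold pNe
  have hsub : (univ.filter fun x : Edges n → Bool => f x ≠ g x) ⊆
      (univ.filter fun x => f x ≠ h x) ∪ (univ.filter fun x => g x ≠ h x) := by
    intro x hx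
    simp only [mem_filter, mem_univ, true_and, mem_union] at hx ⊢
    by_contra hcon
    push Not at hcon
    exact hx (hcon.1.trans hcon.2.symm)
  refine (gnpProb_mono hq0 hq1 hsub).trans ?_
  have hh := Finset.sum_union_inter (s₁ := (univ.filter fun x : Edges n → Bool => f x ≠ h x))
    (s₂ := (univ.filter fun x => g x ≠ h x)) (f := gnpWeight n q)
  have h0 := gnpProb_nonneg hq0 hq1 ((univ.filter fun x : Edges n → Bool => f x ≠ h x) ∩
    (univ.filter fun x => g x ≠ h x))
  unfold gnpProb at hh h0 ⊢
  linarith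

/-- `Pr[f = b] ≤ Pr[g = b] + Pr[f ≠ g]`. [folklore] -/
theorem pEq_le_pEq_add_pNe {n : ℕ} {q : ℝ} (hq0 : 0 ≤ q) (hq1 : q ≤ 1) (f g : (Edges n → Bool) → Bool)
    (b : Bool) : pEq n q f b ≤ pEq n q g b + pNe n q g f := by
  unfold pEq pNe
  have hsub : (univ.filter fun x : Edges n → Bool => f x = b) ⊆
      (univ.filter fun x => g x = b) ∪ (univ.filter fun x => g x ≠ f x) := by
    intro x hx
    simp only [mem_filter, mem_univ, true_and, mem_union] at hx ⊢
    by_cases hg : g x = b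
    · exact Or.inl hg
    · right; rw [hx]; exact hg
  refine (gnpProb_mono hq0 hq1 hsub).trans ?_
  have hh := Finset.sum_union_inter (s₁ := (univ.filter fun x : Edges n → Bool => g x = b))
    (s₂ := (univ.filter fun x => g x ≠ f x)) (f := gnpWeight n q)
  have h0 := gnpProb_nonneg hq0 hq1 ((univ.filter fun x : Edges n → Bool => g x = b) ∩
    (univ.filter fun x => g x ≠ f x))
  unfold gnpProb at hh h0 ⊢
  linarith

/-- **Independent predictors**: if `f` reads only `F` and `g` only `Fᶜ`, then
`Pr[f ≠ g] = Pr[f=1]Pr[g=0] + Pr[f=0]Pr[g=1]`. [folklore] -/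
theorem pNe_eq_of_indep {n : ℕ} (q : ℝ) (F : Finset (Edges n)) (f g : (Edges n → Bool) → Bool)
    (hf : ∀ x y : Edges n → Bool, (∀ e ∈ F, x e = y e) → f x = f y)
    (hg : ∀ x y : Edges n → Bool, (∀ e ∉ F, x e = y e) → g x = g y) :
    pNe n q f g = pEq n q f true * pEq n q g false + pEq n q f false * pEq n q g true := by
  classical
  have hsplit : (univ.filter fun x : Edges n → Bool => f x ≠ g x) =
      (univ.filter fun x => f x = true ∧ g x = false) ∪ (univ.filter fun x => f x = false ∧ g x = true) := by
    ext x
    simp only [mem_filter, mem_univ, true_and, mem_union]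
    cases f x <;> cases g x <;> simp
  have hdisj : Disjoint (univ.filter fun x : Edges n → Bool => f x = true ∧ g x = false)
      (univ.filter fun x => f x = false ∧ g x = true) := by
    rw [Finset.disjoint_filter]
    intro x _ h1 h2
    rw [h1.1] at h2
    exact Bool.noConfusion h2.1
  have e1 := gnpProb_and_eq_mul F (fun x => f x = true) (fun x => g x = false)
    (fun x y hxy => by rw [hf x y hxy]) (fun x y hxy => by rw [hg x y hxy]) q
  have e2 := gnpProb_and_eq_mul F (fun x => f x = false) (fun x => g x = true)
    (fun x y hxy => by rw [hf x y hxy]) (fun x y hxy => by rw [hg x y hxy]) q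
  unfold pNe pEq
  rw [hsplit, gnpProb, Finset.sum_union hdisj]
  change gnpProb n q _ + gnpProb n q _ = _
  rw [e1, e2]

/-- A mixture of `Pr[g=0]` and `Pr[g=1]` with weights `Pr[f=1], Pr[f=0]` is at least the minimum.
[folklore] -/
theorem min_le_pNe_of_indep {n : ℕ} {q : ℝ} (hq0 : 0 ≤ q) (hq1 : q ≤ 1) (F : Finset (Edges n))
    (f g : (Edges n → Bool) → Bool)
    (hf : ∀ x y : Edges n → Bool, (∀ e ∈ F, x e = y e) → f x = f y)
    (hg : ∀ x y : Edges n → Bool, (∀ e ∉ F, x e = y e) → g x = g y) :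
    min (pEq n q g false) (pEq n q g true) ≤ pNe n q f g := by
  rw [pNe_eq_of_indep q F f g hf hg]
  have hsum := pEq_true_add_false q f
  have h1 := pEq_nonneg hq0 hq1 f true
  have h0 := pEq_nonneg hq0 hq1 f false
  have ha : pEq n q f true * min (pEq n q g false) (pEq n q g true) ≤ pEq n q f true * pEq n q g false :=
    mul_le_mul_of_nonneg_left (min_le_left _ _) h1
  have hb : pEq n q f false * min (pEq n q g false) (pEq n q g true) ≤ pEq n q f false * pEq n q g true :=
    mul_le_mul_of_nonneg_left (min_le_right _ _) h0
  have hm : min (pEq n q g false) (pEq n q g true) =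
      pEq n q f true * min (pEq n q g false) (pEq n q g true) +
        pEq n q f false * min (pEq n q g false) (pEq n q g true) := by
    rw [← add_mul, hsum, one_mul]
  linarith

/-- The `F`-blind clique indicator `CLIQUE_k(x ∖ F)` differs from `CLIQUE_k` only on inputs with a
clique touching `F`. [folklore] -/
theorem pNe_zeroOn_le_pTouch {n k : ℕ} {q : ℝ} (hq0 : 0 ≤ q) (hq1 : q ≤ 1) (F : Finset (Edges n)) :
    pNe n q (fun x => cliqueFn n k (zeroOn F x)) (cliqueFn n k) ≤ pTouch n k q F :=
  gnpProb_mono hq0 hq1 fun x hx => by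
    simp only [mem_filter, mem_univ, true_and] at hx ⊢
    exact touch_of_ne F x hx

/-- `Pr[CLIQUE = 0] ≤ Pr[CLIQUE(· ∖ F) = 0]`. [folklore] -/
theorem pEq_clique_false_le {n k : ℕ} {q : ℝ} (hq0 : 0 ≤ q) (hq1 : q ≤ 1) (F : Finset (Edges n)) :
    pEq n q (cliqueFn n k) false ≤ pEq n q (fun x => cliqueFn n k (zeroOn F x)) false :=
  gnpProb_mono hq0 hq1 fun x hx => by
    simp only [mem_filter, mem_univ, true_and] at hx ⊢
    have hle : cliqueFn n k (zeroOn F x) ≤ cliqueFn n k x := cliqueFn_monotone_holds n k (zeroOn_le F x)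
    rw [hx] at hle
    exact le_antisymm hle (Bool.false_le _)

/-- `Pr[some k-clique touches F] ≤ |F| C(n-2,k-2) q^{C(k,2)}`. [folklore] -/
theorem pTouch_le {n k : ℕ} {q : ℝ} (hq0 : 0 ≤ q) (hq1 : q ≤ 1) (F : Finset (Edges n)) :
    pTouch n k q F ≤ #F * ((n - 2).choose (k - 2) : ℝ) * q ^ (k.choose 2) :=
  gnpProb_clique_touching_le (k := k) F hq0 hq1

/-- **Locality lower bound.** If the circuit `C` only reads edges in `F`, then on `G(n,q)`
`Pr[C ≠ CLIQUE_k] ≥ min(Pr[CLIQUE_k = 0], Pr[CLIQUE_k = 1] - τ) - τ` with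
`τ = Pr[some k-clique touches F] ≤ |F| C(n-2,k-2) q^{C(k,2)}`: the output of `C` is independent of
the `F`-blind indicator `CLIQUE_k(x ∖ F)`, which agrees with `CLIQUE_k` off the touching event.
[folklore] -/
theorem err_ge_of_reads {n k : ℕ} {q : ℝ} (hq0 : 0 ≤ q) (hq1 : q ≤ 1) (C : Circuit (Edges n))
    (F : Finset (Edges n)) (hF : ∀ i ∈ inputList C, i ∈ F) :
    min (pEq n q (cliqueFn n k) false) (pEq n q (cliqueFn n k) true - pTouch n k q F) - pTouch n k q F ≤
      pNe n q (fun x => C.eval x) (cliqueFn n k) := by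
  set g : (Edges n → Bool) → Bool := fun x => cliqueFn n k (zeroOn F x) with hg
  have hf : ∀ x y : Edges n → Bool, (∀ e ∈ F, x e = y e) → C.eval x = C.eval y :=
    fun x y hxy => eval_congr C fun i hi => hxy i (hF i hi)
  have hg' : ∀ x y : Edges n → Bool, (∀ e ∉ F, x e = y e) → g x = g y := by
    intro x y hxy
    simp only [hg]
    rw [zeroOn_congr_off hxy]
  have h1 : pNe n q (fun x => C.eval x) g ≤ pNe n q (fun x => C.eval x) (cliqueFn n k) +
      pNe n q g (cliqueFn n k) := pNe_triangle hq0 hq1 _ _ _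
  have h2 : pNe n q g (cliqueFn n k) ≤ pTouch n k q F := pNe_zeroOn_le_pTouch hq0 hq1 F
  have h3 : min (pEq n q g false) (pEq n q g true) ≤ pNe n q (fun x => C.eval x) g :=
    min_le_pNe_of_indep hq0 hq1 F _ g hf hg'
  have h4 : pEq n q (cliqueFn n k) false ≤ pEq n q g false := pEq_clique_false_le hq0 hq1 F
  have h5 : pEq n q (cliqueFn n k) true ≤ pEq n q g true + pNe n q g (cliqueFn n k) :=
    pEq_le_pEq_add_pNe hq0 hq1 _ g true
  have h6 : min (pEq n q (cliqueFn n k) false) (pEq n q (cliqueFn n k) true - pTouch n k q F) ≤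
      min (pEq n q g false) (pEq n q g true) := min_le_min h4 (by linarith)
  linarith

/-! ### (h.5) The crux holds below `n²` for free: `LowerBoundAt c k δ` for `c ≤ 1`, every `k ≥ 3` -/

/-- `p_c^{C(k,2)} = n^{-k}`. [folklore] -/
theorem pc_pow_choose {n k : ℕ} (hn : 1 ≤ n) (hk : 2 ≤ k) : pc n k ^ (k.choose 2) = ((n : ℝ) ^ k)⁻¹ := by
  have hn0 : (0 : ℝ) < n := by exact_mod_cast hn
  have hk1 : (k : ℝ) - 1 ≠ 0 := by
    have : (2 : ℝ) ≤ k := by exact_mod_cast hk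
    linarith
  unfold pc
  rw [← Real.rpow_natCast, ← Real.rpow_mul hn0.le, Nat.cast_choose_two]
  have : -2 / ((k : ℝ) - 1) * ((k : ℝ) * ((k : ℝ) - 1) / 2) = -(k : ℝ) := by
    field_simp
  rw [this, Real.rpow_neg hn0.le, Real.rpow_natCast]

/-- The touching budget of a circuit reading `≤ 2n^c + 1` edges vanishes for `c ≤ 1`:
`(2n^c+1) · C(n-2,k-2) · p_c^{C(k,2)} ≤ 3/n`. [folklore] -/
theorem touchBudget_le {n k c : ℕ} (hn : 1 ≤ n) (hk : 2 ≤ k) (hc : c ≤ 1) :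
    (2 * (n : ℝ) ^ c + 1) * ((n - 2).choose (k - 2) : ℝ) * pc n k ^ (k.choose 2) ≤ 3 / n := by
  have hn0 : (0 : ℝ) < n := by exact_mod_cast hn
  rw [pc_pow_choose hn hk]
  have h1 : (2 * (n : ℝ) ^ c + 1) ≤ 3 * n := by
    have : (n : ℝ) ^ c ≤ n := by
      rcases Nat.le_one_iff_eq_zero_or_eq_one.1 hc with rfl | rfl
      · simp; exact_mod_cast hn
      · simp
    have h1' : (1 : ℝ) ≤ n := by exact_mod_cast hn
    linarith
  have h2 : ((n - 2).choose (k - 2) : ℝ) ≤ (n : ℝ) ^ (k - 2) := by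
    have ha : (n - 2).choose (k - 2) ≤ (n - 2) ^ (k - 2) := Nat.choose_le_pow _ _
    have hb : (n - 2) ^ (k - 2) ≤ n ^ (k - 2) := Nat.pow_le_pow_left (Nat.sub_le n 2) _
    exact_mod_cast ha.trans hb
  have hk2 : (n : ℝ) ^ k = (n : ℝ) ^ (k - 2) * n * n := by
    rw [← pow_succ, ← pow_succ]
    congr 1
    omega
  calc (2 * (n : ℝ) ^ c + 1) * ((n - 2).choose (k - 2) : ℝ) * ((n : ℝ) ^ k)⁻¹
      ≤ (3 * n) * (n : ℝ) ^ (k - 2) * ((n : ℝ) ^ k)⁻¹ := by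
        have : 0 ≤ ((n : ℝ) ^ k)⁻¹ := inv_nonneg.2 (pow_nonneg hn0.le _)
        have : (0 : ℝ) ≤ (n - 2).choose (k - 2) := Nat.cast_nonneg _
        gcongr
    _ = 3 / n := by
        rw [hk2]
        field_simp

/-- **Below `n²` the crux holds for free (locality).** For `c ≤ 1` and every `k ≥ 3` there is
`δ > 0` (namely a quarter of the in-tree lower bound `η_k` on `Pr[ω_k = 1]`) such that, eventually,
every monotone circuit of size `≤ n^c` errs with probability `> δ`: it reads `≤ 2n^c + 1 = o(n²)`
edges, which w.h.p. touch no `k`-clique, so its output is independent of `CLIQUE_k`. The contentful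
range of the crux therefore starts at `c = 2`. [folklore] -/
theorem lowerBoundAt_of_le_one {c k : ℕ} (hc : c ≤ 1) (hk : 3 ≤ k) :
    ∃ δ : ℝ, 0 < δ ∧ LowerBoundAt c k δ := by
  have hk2 : 2 ≤ k := by omega
  set η : ℝ := (1 : ℝ) ^ k.choose 2 / (2 ^ k * k.factorial) *
    Real.exp (-(2 * (k * 2 ^ k * (1 : ℝ) ^ k.choose 2))) with hη
  have hη0 : 0 < η := by positivity
  have hηe : η ≤ Real.exp (-2) := by
    have ha : (1 : ℝ) ^ k.choose 2 / (2 ^ k * k.factorial) ≤ 1 := by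
      rw [one_pow, div_le_one (by positivity)]
      have h2 : (1 : ℝ) ≤ 2 ^ k := one_le_pow₀ (by norm_num)
      have h3 : (1 : ℝ) ≤ k.factorial := by exact_mod_cast Nat.one_le_iff_ne_zero.2 (Nat.factorial_ne_zero k)
      nlinarith
    have hb : Real.exp (-(2 * (k * 2 ^ k * (1 : ℝ) ^ k.choose 2))) ≤ Real.exp (-2) := by
      rw [Real.exp_le_exp]
      have h2 : (1 : ℝ) ≤ 2 ^ k := one_le_pow₀ (by norm_num)
      have h3 : (3 : ℝ) ≤ k := by exact_mod_cast hk
      rw [one_pow, mul_one]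
      nlinarith
    calc η = (1 : ℝ) ^ k.choose 2 / (2 ^ k * k.factorial) *
        Real.exp (-(2 * (k * 2 ^ k * (1 : ℝ) ^ k.choose 2))) := hη
      _ ≤ 1 * Real.exp (-2) := by
          gcongr
      _ = Real.exp (-2) := one_mul _
  -- eventual lower bounds on `Pr[ω_k = 1]` and `Pr[ω_k = 0]`
  have hpc1 : ∀ᶠ n : ℕ in atTop, (1 : ℝ) * (n : ℝ) ^ (-(2 : ℝ) / ((k : ℝ) - 1)) ≤ pc n k ∧
      pc n k ≤ 1 * (n : ℝ) ^ (-(2 : ℝ) / ((k : ℝ) - 1)) :=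
    Eventually.of_forall fun n => by simp [pc]
  have h1 := eventually_le_gnpProb_cliqueCount_eq_one hk2 (p := fun n => pc n k) one_pos le_rfl hpc1
  have hpc0 : ∀ᶠ n : ℕ in atTop, 0 ≤ pc n k ∧ pc n k ≤ 1 * (n : ℝ) ^ (-(2 : ℝ) / ((k : ℝ) - 1)) :=
    Eventually.of_forall fun n => ⟨pc_nonneg n k, by simp [pc]⟩
  have h0 := eventually_le_gnpProb_cliqueFree hk2 (p := fun n => pc n k) (b := 1) le_rfl hpc0
  -- the touching budget vanishes
  have hτ : ∀ᶠ n : ℕ in atTop, (3 : ℝ) / n ≤ η / 4 := by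
    have := tendsto_const_div_atTop_nhds_zero_nat (3 : ℝ)
    exact this.eventually (eventually_le_nhds (by positivity))
  refine ⟨η / 4, by positivity, ?_⟩
  filter_upwards [h1, h0, hτ, eventually_ge_atTop 1] with n hn1 hn0 hτn hn
  intro C hC herr
  by_contra hsize
  push Not at hsize
  have hq0 := pc_nonneg n k
  have hq1 := pc_le_one hn hk2
  -- the edges `C` reads
  set F : Finset (Edges n) := (inputList C).toFinset with hF
  have hFmem : ∀ i ∈ inputList C, i ∈ F := fun i hi => List.mem_toFinset.2 hi
  have hFcard : (#F : ℝ) ≤ 2 * (n : ℝ) ^ c + 1 := by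
    have h1 : #F ≤ (inputList C).length := List.toFinset_card_le _
    have h2 := length_inputList_le C (arity_le_two_of_isOver hC)
    have h3 : #F ≤ 2 * n ^ c + 1 := by omega
    exact_mod_cast h3
  -- touching probability
  have hτ' : pTouch n k (pc n k) F ≤ η / 4 := by
    refine (pTouch_le hq0 hq1 F).trans ?_
    refine le_trans ?_ ((touchBudget_le hn hk2 hc).trans hτn)
    have : (0 : ℝ) ≤ ((n - 2).choose (k - 2) : ℝ) * pc n k ^ (k.choose 2) :=
      mul_nonneg (Nat.cast_nonneg _) (pow_nonneg hq0 _)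
    nlinarith
  -- the two constants
  have hPc1 : η ≤ pEq n (pc n k) (cliqueFn n k) true := by
    refine hn1.trans (gnpProb_mono hq0 hq1 fun x hx => ?_)
    simp only [mem_filter, mem_univ, true_and] at hx ⊢
    exact (cliqueCount_ne_zero_iff x).1 (by rw [hx]; exact one_ne_zero)
  have hPc0 : Real.exp (-2) ≤ pEq n (pc n k) (cliqueFn n k) false := by
    have h := hn0
    simp only [one_pow, mul_one] at h
    refine h.trans (gnpProb_mono hq0 hq1 fun x hx => ?_)
    simp only [mem_filter, mem_univ, true_and] at hx ⊢
    exact (cliqueCount_eq_zero_iff x).1 hx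
  -- locality
  have hmain := err_ge_of_reads (k := k) hq0 hq1 C F hFmem
  have herr' : err n k C = pNe n (pc n k) (fun x => C.eval x) (cliqueFn n k) := rfl
  rw [← herr'] at hmain
  have hmin : 3 * η / 4 ≤ min (pEq n (pc n k) (cliqueFn n k) false)
      (pEq n (pc n k) (cliqueFn n k) true - pTouch n k (pc n k) F) :=
    le_min (by linarith) (by linarith)
  linarith

/-! ## (i) Targets (cycle 2): the stubs of skeleton `Lines/self-noise-closure.lean`

Attacked signatures (registered 2026-08-16T03:18Z, skeleton sha `38768f89…`; file revised 03:28Z with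
`∃ a ≥ k + c`): `stub_structuralApprox`, `stub_plantedAcceptance`, `stub_selfNoiseLemma15`,
`stub_fewCliqueMinterms`, `stub_positiveTrigger`. Verdicts of the cheap arsenal: see the index entry (i)
in the module docstring; stubs 1–4 TRUE in substance, stub 5 ⇔ crux (modulo 1–4). The theorems below
isolate the load-bearing hypotheses of stub 5: everything except the PROGRAM is provably insufficient,
for every `k` and every accuracy. (Filed for landing as `Theorems/SingleThreshold/Negative/`
`PlantedCliqueFree.lean`, `CriticalDecay.lean`, `PositiveTrigger.lean` — same names, namespace
`…Theorems.SingleThreshold.Negative`.)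
-/

section Targets

variable {n : ℕ}

/-! ### Planting a small pattern keeps clique-freeness likely -/

/-- The edges of `K_B` that are NOT switched on by the pattern `h`. [folklore] -/
def outEdges (B : Finset (Fin n)) (h : Edges n → Bool) : Finset (Edges n) :=
  univ.filter fun e => cliqueVec B e = true ∧ h e = false

/-- `Pr[K_B ⊆ G ∪ h] = p^{#outEdges B h}` (only the edges of `K_B` outside `h` have to be present).
[folklore] -/
theorem gnpProb_forall_cliqueVec_sup_pattern (p : ℝ) (B : Finset (Fin n)) (h : Edges n → Bool) :
    gnpProb n p (univ.filter fun x : Edges n → Bool =>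
        ∀ e, cliqueVec B e = true → (x ⊔ h) e = true) = p ^ #(outEdges B h) := by
  rw [← sum_gnpWeight_filter_forall, gnpProb]
  refine sum_congr (filter_congr fun x _ => ?_) fun _ _ => rfl
  simp only [outEdges, mem_filter, mem_univ, true_and, sup_apply_bool, Bool.or_eq_true]
  constructor
  · rintro hx e ⟨hB, hh⟩
    rcases hx e hB with h1 | h1
    · exact h1
    · rw [hh] at h1
      exact absurd h1 Bool.false_ne_true
  · intro hx e hB
    by_cases hh : h e = true
    · exact Or.inr hh
    · exact Or.inl (hx e ⟨hB, Bool.eq_false_iff.2 hh⟩)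

/-- If the support of `h` lies inside the `k`-set `A`, the edges of `K_B` outside `K_A` are outside
`h`: `C(|B|,2) - C(|A ∩ B|,2) ≤ #outEdges B h`. [folklore] -/
theorem choose_sub_le_card_outEdges (A B : Finset (Fin n)) (h : Edges n → Bool)
    (hA : supp h ⊆ A) : (#B).choose 2 - (#(A ∩ B)).choose 2 ≤ #(outEdges B h) := by
  rw [← card_filter_cliqueVec_and_not A B]
  refine card_le_card fun e he => ?_
  simp only [mem_filter, mem_univ, true_and, outEdges] at he ⊢
  refine ⟨he.1, ?_⟩
  by_contra hhe
  rw [Bool.not_eq_false] at hhe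
  have : cliqueVec A e = true :=
    (cliqueVec_eq_true_iff_endpts A e).2 ((endpts_subset_supp hhe).trans hA)
  rw [he.2] at this
  exact Bool.false_ne_true this

/-- A `k`-set `B` (`k ≥ 2`) has an edge outside any pattern with fewer than `k` non-isolated
vertices. [folklore] -/
theorem one_le_card_outEdges {k : ℕ} (hk : 2 ≤ k) {B : Finset (Fin n)} (hB : #B = k)
    {h : Edges n → Bool} (hh : #(supp h) < k) : 1 ≤ #(outEdges B h) := by
  -- a vertex of `B` outside the support of `h`, and a second vertex of `B`
  obtain ⟨u, huB, hu⟩ : ∃ u ∈ B, u ∉ supp h := by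
    by_contra hno
    push Not at hno
    have := card_le_card (show B ⊆ supp h from hno)
    omega
  have hcard : 1 < #B := by omega
  obtain ⟨v, hvB, hvu⟩ := exists_mem_ne hcard u
  rw [Nat.one_le_iff_ne_zero, Ne, card_eq_zero, ← Ne, ← nonempty_iff_ne_empty]
  refine ⟨⟨s(u, v), by simpa using hvu.symm⟩, mem_filter.2 ⟨mem_univ _, ?_, ?_⟩⟩
  · simp only [cliqueVec, decide_eq_true_eq]
    intro w hw
    rcases Sym2.mem_iff.1 hw with rfl | rfl
    · exact huB
    · exact hvB
  · by_contra hon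
    rw [Bool.not_eq_false] at hon
    exact hu (endpts_subset_supp hon ((mem_endpts _ u).2 (Sym2.mem_mk_left u v)))

/-- **Planted Harris bound.** For `0 ≤ p ≤ 1/2`, `k ≥ 2` and a pattern `h` with fewer than `k`
non-isolated vertices: `Pr[ω_k(G ∪ h) = 0] ≥ exp(-2 Σ_B p^{#outEdges B h})`, the product over the
decreasing events `K_B ⊈ G ∪ h` (Harris) evaluated termwise (`1 - q ≥ e^{-2q}` for `q ≤ 1/2`).
[cite: Rossman2010, App. B (proof of Lemma 23 (a), p. 14)] -/
theorem le_gnpProb_cliqueFree_sup {p : ℝ} (hp0 : 0 ≤ p) (hp : p ≤ 1 / 2) {k : ℕ} (hk : 2 ≤ k)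
    {h : Edges n → Bool} (hh : #(supp h) < k) :
    Real.exp (-(2 * ∑ B ∈ powersetCard k (univ : Finset (Fin n)), p ^ #(outEdges B h))) ≤
      gnpProb n p (univ.filter fun x : Edges n → Bool => cliqueFn n k (x ⊔ h) = false) := by
  have hp1 : p ≤ 1 := hp.trans (by norm_num)
  set 𝒜 := powersetCard k (univ : Finset (Fin n)) with h𝒜
  -- Harris
  have hD : ∀ B ∈ 𝒜, ∀ x y : Edges n → Bool, x ≤ y →
      ¬ (∀ e, cliqueVec B e = true → (y ⊔ h) e = true) →
        ¬ (∀ e, cliqueVec B e = true → (x ⊔ h) e = true) :=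
    fun B _ x y hxy hy hx => hy (forall_cliqueVec_of_le B (sup_le_sup_right hxy _) hx)
  have step3 : ∏ B ∈ 𝒜, gnpProb n p (univ.filter fun x : Edges n → Bool =>
        ¬ ∀ e, cliqueVec B e = true → (x ⊔ h) e = true) ≤
      gnpProb n p (univ.filter fun x : Edges n → Bool =>
        ∀ B ∈ 𝒜, ¬ ∀ e, cliqueVec B e = true → (x ⊔ h) e = true) := by
    convert prod_gnpProb_le_gnpProb_forall hp0 hp1 𝒜
      (fun B x => ¬ ∀ e, cliqueVec B e = true → (x ⊔ h) e = true) hD using 3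
  -- each factor
  have step4 : ∀ B ∈ 𝒜, gnpProb n p (univ.filter fun x : Edges n → Bool =>
      ¬ ∀ e, cliqueVec B e = true → (x ⊔ h) e = true) = 1 - p ^ #(outEdges B h) := by
    intro B _
    have hset : (univ.filter fun x : Edges n → Bool =>
        ¬ ∀ e, cliqueVec B e = true → (x ⊔ h) e = true) =
        (univ.filter fun x : Edges n → Bool => ∀ e, cliqueVec B e = true → (x ⊔ h) e = true)ᶜ := by
      ext x; simp
    rw [hset, gnpProb_compl, gnpProb_forall_cliqueVec_sup_pattern]
  have step5 : Real.exp (-(2 * ∑ B ∈ 𝒜, p ^ #(outEdges B h))) ≤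
      ∏ B ∈ 𝒜, (1 - p ^ #(outEdges B h)) := by
    refine exp_neg_two_mul_sum_le_prod_one_sub _ _ (fun B _ => pow_nonneg hp0 _) fun B hB => ?_
    have hBk : #B = k := (mem_powersetCard.1 hB).2
    calc p ^ #(outEdges B h) ≤ p ^ 1 := pow_le_pow_of_le_one hp0 hp1 (one_le_card_outEdges hk hBk hh)
      _ ≤ 1 / 2 := by rwa [pow_one]
  -- the target event
  have step6 : gnpProb n p (univ.filter fun x : Edges n → Bool =>
        ∀ B ∈ 𝒜, ¬ ∀ e, cliqueVec B e = true → (x ⊔ h) e = true) =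
      gnpProb n p (univ.filter fun x : Edges n → Bool => cliqueFn n k (x ⊔ h) = false) := by
    congr 1
    refine filter_congr fun x _ => ?_
    rw [← cliqueCount_eq_zero_iff_forall, cliqueCount_eq_zero_iff]
  calc Real.exp (-(2 * ∑ B ∈ 𝒜, p ^ #(outEdges B h)))
      ≤ ∏ B ∈ 𝒜, (1 - p ^ #(outEdges B h)) := step5
    _ = ∏ B ∈ 𝒜, gnpProb n p (univ.filter fun x : Edges n → Bool =>
          ¬ ∀ e, cliqueVec B e = true → (x ⊔ h) e = true) :=
        prod_congr rfl fun B hB => (step4 B hB).symm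
    _ ≤ _ := step3
    _ = _ := step6

/-- **The overlap sum for a small pattern at the threshold**: for `n ≥ k ≥ 2`,
`0 ≤ p ≤ n^{-2/(k-1)}` and `#supp h < k`, `Σ_B p^{#outEdges B h} ≤ 1 + k 2^k` (choose a `k`-set
`A ⊇ supp h`; the term `B = A` is `≤ 1`, the others are `≤ p^{C(k,2) - C(|A∩B|,2)}`, summed by
`sum_erase_pow_inter_le`). [cite: Rossman2010, App. B (proof of Lemma 23 (a), p. 14)] -/
theorem sum_pow_outEdges_le {k : ℕ} (hk : 2 ≤ k) (hkn : k ≤ n) {p : ℝ} (hp0 : 0 ≤ p) (hp1 : p ≤ 1)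
    (hpb : p ≤ 1 * (n : ℝ) ^ (-(2 : ℝ) / ((k : ℝ) - 1))) {h : Edges n → Bool} (hh : #(supp h) < k) :
    ∑ B ∈ powersetCard k (univ : Finset (Fin n)), p ^ #(outEdges B h) ≤ 1 + k * 2 ^ k := by
  have hn : 1 ≤ n := by omega
  -- a `k`-set containing the support of `h`
  obtain ⟨A, hhA, -, hAk⟩ : ∃ A : Finset (Fin n), supp h ⊆ A ∧ A ⊆ univ ∧ #A = k :=
    exists_subsuperset_card_eq (subset_univ _) hh.le (by rwa [card_univ, Fintype.card_fin])
  have hA : A ∈ powersetCard k (univ : Finset (Fin n)) := mem_powersetCard.2 ⟨subset_univ _, hAk⟩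
  rw [← add_sum_erase _ _ hA]
  refine add_le_add (pow_le_one₀ hp0 hp1) ?_
  calc ∑ B ∈ (powersetCard k (univ : Finset (Fin n))).erase A, p ^ #(outEdges B h)
      ≤ ∑ B ∈ (powersetCard k (univ : Finset (Fin n))).erase A,
          p ^ (k.choose 2 - (#(A ∩ B)).choose 2) := by
        refine sum_le_sum fun B hB => pow_le_pow_of_le_one hp0 hp1 ?_
        have hBk : #B = k := (mem_powersetCard.1 (mem_erase.1 hB).2).2
        rw [← hBk]
        exact choose_sub_le_card_outEdges A B h hhA
    _ ≤ k * 2 ^ k * (1 : ℝ) ^ k.choose 2 := sum_erase_pow_inter_le hk hn hp0 le_rfl hpb hA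
    _ = k * 2 ^ k := by rw [one_pow, mul_one]

/-- The constant `e^{-2(1 + k 2^k)}`: an eventual lower bound for `Pr[ω_k(G(n,p_c) ∪ h) = 0]` over all
patterns `h` with fewer than `k` non-isolated vertices. [folklore] -/
def cfree (k : ℕ) : ℝ := Real.exp (-(2 * (1 + k * 2 ^ k)))

/-- `cfree k > 0`. [folklore] -/
theorem cfree_pos (k : ℕ) : 0 < cfree k := Real.exp_pos _

/-- **Eventually, planting any pattern of support `< k` leaves `G(n,p_c)` clique-free with
probability `≥ cfree k = e^{-2(1+k2^k)}`.** [cite: Rossman2010, App. B (p. 14)] -/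
theorem eventually_le_gnpProb_cliqueFree_sup {k : ℕ} (hk : 2 ≤ k) :
    ∀ᶠ n : ℕ in atTop, ∀ h : Edges n → Bool, #(supp h) < k →
      cfree k ≤ gnpProb n (pc n k) (univ.filter fun x : Edges n → Bool => cliqueFn n k (x ⊔ h) = false) := by
  have hhalf : ∀ᶠ n : ℕ in atTop, pc n k ≤ 1 / 2 := (tendsto_pc hk).eventually_le_const (by norm_num)
  filter_upwards [hhalf, eventually_ge_atTop k] with n hpn hkn h hh
  have hp0 := pc_nonneg n k
  have hp1 : pc n k ≤ 1 := hpn.trans (by norm_num)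
  have hpb : pc n k ≤ 1 * (n : ℝ) ^ (-(2 : ℝ) / ((k : ℝ) - 1)) := by rw [one_mul]; exact le_rfl
  refine le_trans ?_ (le_gnpProb_cliqueFree_sup hp0 hpn hk hh)
  rw [cfree, Real.exp_le_exp, neg_le_neg_iff]
  exact mul_le_mul_of_nonneg_left (sum_pow_outEdges_le hk hkn hp0 hp1 hpb hh) (by norm_num)

/-! ### Every `f ≤ CLIQUE_k` is ⋆-closed at the critical self-noise parameters -/

/-- Members of `smallI ∪ medJ` have fewer than `k` non-isolated vertices. [folklore] -/
theorem card_supp_lt_of_mem_smallI_union_medJ {k : ℕ} {h : Edges n → Bool}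
    (hh : h ∈ smallI n k ∪ medJ n k) : #(supp h) < k := by
  rcases mem_union.1 hh with h1 | h1
  · rw [mem_smallI] at h1; omega
  · rw [mem_medJ] at h1
    obtain ⟨-, x, hx, y, hy, rfl⟩ := h1
    rw [mem_smallI] at hx hy
    rw [supp_sup]
    have := card_union_le (supp x) (supp y)
    omega

/-- **Sub-clique functions are ⋆-closed for free.** If `f ≤ CLIQUE_k` pointwise, the trigger `t` is
below `cfree k`, every pattern of `K` has support `< k`, and `n` is large
(`eventually_le_gnpProb_cliqueFree_sup`), then `f` is ⋆-closed for `(p_c, t, K)`: for every `h ∈ K`,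
`Pr[f(G ∪ h) = 0] ≥ Pr[ω_k(G ∪ h) = 0] ≥ cfree k > t`, so the closure condition is never triggered.
No monotonicity needed. [folklore] -/
theorem isClosedFn_of_le_cliqueFn {k : ℕ} (hk : 2 ≤ k) (hn1 : 1 ≤ n)
    (hn : ∀ h : Edges n → Bool, #(supp h) < k →
      cfree k ≤ gnpProb n (pc n k) (univ.filter fun x : Edges n → Bool => cliqueFn n k (x ⊔ h) = false))
    {t : ℝ} (ht : t < cfree k) {K : Finset (Edges n → Bool)} (hK : ∀ h ∈ K, #(supp h) < k)
    {f : (Edges n → Bool) → Bool} (hf : ∀ x, f x = true → cliqueFn n k x = true) :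
    IsClosedFn (pc n k) t K f := by
  intro h hhK hfails
  exfalso
  have h1 : gnpProb n (pc n k) (univ.filter fun x : Edges n → Bool => cliqueFn n k (x ⊔ h) = false) ≤
      fails (pc n k) f h := by
    rw [fails, gnpProb_filter_eq_prob]
    refine prob_mono (pc_nonneg n k) (pc_le_one hn1 hk) fun x hx => ?_
    by_contra hfx
    rw [Bool.not_eq_false] at hfx
    have := hf _ hfx
    rw [hx] at this
    exact Bool.false_ne_true this
  have := (hn h (hK h hhK)).trans (h1.trans hfails)
  linarith

/-! ### Generic `G(n,p)` / random-`k`-set bookkeeping -/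

/-- `Pr[no edge of F is on] = (1-p)^{#F}`. [folklore] -/
theorem gnpProb_forall_off (p : ℝ) (F : Finset (Edges n)) :
    gnpProb n p (univ.filter fun x : Edges n → Bool => ∀ e ∈ F, x e = false) = (1 - p) ^ #F := by
  have h := gnpProb_forall_not_allOn (n := n) F (fun e => ({e} : Finset (Edges n)))
    (fun i _ j _ hij => by simpa [Function.onFun] using hij) p
  simp only [mem_singleton, forall_eq, card_singleton, pow_one, prod_const] at h
  rw [← h]
  congr 1
  refine filter_congr fun x _ => ?_
  simp only [Bool.not_eq_true]

/-- The edges outside `K_A` number `C(n,2) - C(|A|,2)`. [folklore] -/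
theorem card_filter_cliqueVec_false (A : Finset (Fin n)) :
    #(univ.filter fun e : Edges n => cliqueVec A e = false) = n.choose 2 - (#A).choose 2 := by
  have h := card_filter_add_card_filter_not (s := (univ : Finset (Edges n))) (fun e => cliqueVec A e = true)
  rw [card_filter_cliqueVec, card_univ, card_edgeSet_top_fin] at h
  have h2 : (univ.filter fun e : Edges n => ¬ cliqueVec A e = true) =
      univ.filter fun e : Edges n => cliqueVec A e = false := by
    refine filter_congr fun e _ => ?_
    simp
  rw [h2] at h
  omega

/-- `Pr[G switches on no edge outside K_A] = (1-p)^{C(n,2) - C(|A|,2)}`. [folklore] -/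
theorem gnpProb_off_outside (p : ℝ) (A : Finset (Fin n)) :
    gnpProb n p (univ.filter fun x : Edges n → Bool => ∀ e, cliqueVec A e = false → x e = false) =
      (1 - p) ^ (n.choose 2 - (#A).choose 2) := by
  rw [← card_filter_cliqueVec_false A, ← gnpProb_forall_off p]
  congr 1
  refine filter_congr fun x _ => ?_
  simp only [mem_filter, mem_univ, true_and]

/-- `kSubsetProb` is monotone in the event, tested on `k`-sets only. [folklore] -/
theorem kSubsetProb_mono_card {k : ℕ} {P Q : Finset (Fin n) → Prop} [DecidablePred P] [DecidablePred Q]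
    (h : ∀ A, #A = k → P A → Q A) : kSubsetProb n k P ≤ kSubsetProb n k Q := by
  unfold kSubsetProb
  refine div_le_div_of_nonneg_right ?_ (Nat.cast_nonneg _)
  exact_mod_cast card_le_card fun A hA => by
    rw [mem_filter] at hA ⊢
    exact ⟨hA.1, h A (mem_powersetCard.1 hA.1).2 hA.2⟩

/-- Averaging an event over `G(n,p)` and the uniform `k`-set: swap the two sums. [folklore] -/
theorem sum_gnpWeight_mul_kSubsetProb {k : ℕ} (p : ℝ) (P : (Edges n → Bool) → Finset (Fin n) → Prop)
    [∀ x, DecidablePred (P x)] :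
    ∑ x : Edges n → Bool, gnpWeight n p x * kSubsetProb n k (P x) =
      (∑ A ∈ powersetCard k (univ : Finset (Fin n)), gnpProb n p (univ.filter fun x => P x A)) /
        (n.choose k : ℝ) := by
  have hx : ∀ x : Edges n → Bool, gnpWeight n p x * kSubsetProb n k (P x) =
      (∑ A ∈ powersetCard k (univ : Finset (Fin n)), if P x A then gnpWeight n p x else 0) /
        (n.choose k : ℝ) := by
    intro x
    rw [kSubsetProb, card_filter, mul_div_assoc', Nat.cast_sum, mul_sum]
    congr 1
    refine sum_congr rfl fun A _ => ?_
    split_ifs <;> simp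
  rw [sum_congr rfl fun x _ => hx x, ← sum_div, sum_comm]
  congr 1
  refine sum_congr rfl fun A _ => ?_
  rw [gnpProb_filter]

/-! ### The witness: "a `k`-clique and one more edge" -/

/-- **`cliquePlusEdge`**: "`x` has a `k`-clique and more than `C(k,2)` edges" — the clique function
with the bare cliques `K_A` removed from its accepting set. [folklore] -/
def cliquePlusEdge (n k : ℕ) (x : Edges n → Bool) : Bool :=
  cliqueFn n k x && decide (k.choose 2 < #(onSet x))

/-- `cliquePlusEdge ≤ CLIQUE_k`. [folklore] -/
theorem cliqueFn_of_cliquePlusEdge {k : ℕ} {x : Edges n → Bool} (hx : cliquePlusEdge n k x = true) :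
    cliqueFn n k x = true := by
  rw [cliquePlusEdge, Bool.and_eq_true] at hx
  exact hx.1

/-- `cliquePlusEdge` is monotone. [folklore] -/
theorem monotone_cliquePlusEdge (n k : ℕ) : Monotone (cliquePlusEdge n k) := by
  refine monotone_band (cliqueFn_monotone_holds n k) fun x y hxy => ?_
  rw [Bool.le_iff_imp, decide_eq_true_eq, decide_eq_true_eq]
  intro hx
  exact hx.trans_le (card_le_card ((le_iff_onSet_subset x y).1 hxy))

/-- `K_A` has exactly `C(|A|,2)` on-edges. [folklore] -/
theorem card_onSet_cliqueVec (A : Finset (Fin n)) : #(onSet (cliqueVec A)) = (#A).choose 2 :=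
  card_filter_cliqueVec A

/-- **`cliquePlusEdge` rejects every isolated `k`-clique.** [folklore] -/
theorem cliquePlusEdge_cliqueVec {k : ℕ} {A : Finset (Fin n)} (hA : #A = k) :
    cliquePlusEdge n k (cliqueVec A) = false := by
  rw [cliquePlusEdge, Bool.and_eq_false_iff]
  right
  rw [decide_eq_false_iff_not, card_onSet_cliqueVec, hA]
  exact lt_irrefl _

/-- If `K_A ≤ x` and `x` has at most `C(k,2)` edges (`#A = k`), then `x` switches on no edge outside
`K_A`. [folklore] -/
theorem off_outside_of_few_edges {k : ℕ} {A : Finset (Fin n)} (hA : #A = k) {x : Edges n → Bool}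
    (hAx : ∀ e, cliqueVec A e = true → x e = true) (hfew : #(onSet x) ≤ k.choose 2) :
    ∀ e, cliqueVec A e = false → x e = false := by
  have hsub : onSet (cliqueVec A) ⊆ onSet x := fun e he => by
    rw [mem_onSet] at he ⊢
    exact hAx e he
  have heq : onSet (cliqueVec A) = onSet x :=
    eq_of_subset_of_card_le hsub (by rw [card_onSet_cliqueVec, hA]; exact hfew)
  intro e he
  by_contra hxe
  rw [Bool.not_eq_false] at hxe
  have : e ∈ onSet (cliqueVec A) := by rw [heq]; exact (mem_onSet x e).2 hxe
  rw [mem_onSet, he] at this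
  exact Bool.false_ne_true this

/-- Where `cliquePlusEdge` differs from `CLIQUE_k`: only on bare cliques, i.e. on inputs `x` that
contain some `K_A` and no edge outside it. [folklore] -/
theorem exists_of_cliquePlusEdge_ne {k : ℕ} {x : Edges n → Bool}
    (hx : cliquePlusEdge n k x ≠ cliqueFn n k x) :
    ∃ A ∈ powersetCard k (univ : Finset (Fin n)),
      (∀ e, cliqueVec A e = true → x e = true) ∧ ∀ e, cliqueVec A e = false → x e = false := by
  rcases hcl : cliqueFn n k x with _ | _
  · exfalso
    apply hx
    rw [hcl, cliquePlusEdge, hcl, Bool.false_and]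
  · obtain ⟨A, hAk, hAx⟩ := (cliqueFn_eq_true_iff_exists k x).1 hcl
    have hAx' : ∀ e, cliqueVec A e = true → x e = true :=
      fun e he => hAx e ((cliqueVec_eq_true_iff A e).1 he)
    have hfew : #(onSet x) ≤ k.choose 2 := by
      by_contra hmany
      rw [not_le] at hmany
      apply hx
      rw [hcl, cliquePlusEdge, hcl, Bool.true_and, decide_eq_true hmany]
    exact ⟨A, mem_powersetCard.2 ⟨subset_univ _, hAk⟩, hAx', off_outside_of_few_edges hAk hAx' hfew⟩

/-- Where `cliquePlusEdge` rejects a planted clique: only when the host has no edge outside `K_A`.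
[folklore] -/
theorem off_outside_of_cliquePlusEdge_sup {k : ℕ} {A : Finset (Fin n)} (hA : #A = k)
    {x : Edges n → Bool} (hx : cliquePlusEdge n k (x ⊔ cliqueVec A) = false) :
    ∀ e, cliqueVec A e = false → x e = false := by
  have hAx : ∀ e, cliqueVec A e = true → (x ⊔ cliqueVec A) e = true := fun e he => by
    rw [sup_apply_bool, he, Bool.or_true]
  have hcl : cliqueFn n k (x ⊔ cliqueVec A) = true :=
    (cliqueFn_eq_true_iff_exists k _).2 ⟨A, hA, fun e he => hAx e ((cliqueVec_eq_true_iff A e).2 he)⟩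
  rw [cliquePlusEdge, hcl, Bool.true_and, decide_eq_false_iff_not, not_lt] at hx
  intro e he
  have := off_outside_of_few_edges hA hAx hx e he
  rw [sup_apply_bool, Bool.or_eq_false_iff] at this
  exact this.1

/-! ### Probabilities of the two exceptional events -/

/-- The bare clique `K_A` is the only input containing `K_A` and no edge outside it; its
`G(n,p)`-mass is `p^{C(|A|,2)} (1-p)^{C(n,2)-C(|A|,2)}`. [folklore] -/
theorem gnpProb_bareClique (p : ℝ) (A : Finset (Fin n)) :
    gnpProb n p (univ.filter fun x : Edges n → Bool =>
        (∀ e, cliqueVec A e = true → x e = true) ∧ ∀ e, cliqueVec A e = false → x e = false) =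
      p ^ (#A).choose 2 * (1 - p) ^ (n.choose 2 - (#A).choose 2) := by
  have hset : (univ.filter fun x : Edges n → Bool =>
      (∀ e, cliqueVec A e = true → x e = true) ∧ ∀ e, cliqueVec A e = false → x e = false) =
      {cliqueVec A} := by
    ext x
    simp only [mem_filter, mem_univ, true_and, mem_singleton]
    constructor
    · rintro ⟨h1, h2⟩
      funext e
      rcases hA : cliqueVec A e with _ | _
      · exact h2 e hA
      · exact h1 e hA
    · rintro rfl
      exact ⟨fun e he => he, fun e he => he⟩
  rw [hset, gnpProb, sum_singleton, gnpWeight]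
  have : edgeCount (cliqueVec A) = (#A).choose 2 := card_filter_cliqueVec A
  rw [this]

/-- **The error of the witness**: `Pr[cliquePlusEdge ≠ CLIQUE_k] ≤ C(n,k) p^{C(k,2)} (1-p)^{C(n,2)-C(k,2)}`
(union bound over the bare cliques). [folklore] -/
theorem err_cliquePlusEdge_le {k : ℕ} {p : ℝ} (hp0 : 0 ≤ p) (hp1 : p ≤ 1) :
    gnpProb n p (univ.filter fun x : Edges n → Bool => cliquePlusEdge n k x ≠ cliqueFn n k x) ≤
      (n.choose k : ℝ) * (p ^ k.choose 2 * (1 - p) ^ (n.choose 2 - k.choose 2)) := by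
  have h := Rossman2010L23.gnpProb_filter_le_sum (n := n) hp0 hp1 (powersetCard k (univ : Finset (Fin n)))
    (fun x : Edges n → Bool => cliquePlusEdge n k x ≠ cliqueFn n k x)
    (fun A x => (∀ e, cliqueVec A e = true → x e = true) ∧ ∀ e, cliqueVec A e = false → x e = false)
    (fun x hx => exists_of_cliquePlusEdge_ne hx)
  refine h.trans (le_of_eq ?_)
  rw [sum_congr rfl fun A hA => by rw [gnpProb_bareClique, (mem_powersetCard.1 hA).2], sum_const,
    card_powersetCard, card_univ, Fintype.card_fin, nsmul_eq_mul]

/-- **Planted rejection of the witness**: `Σ_x w(x) Pr_A[cliquePlusEdge(x ∪ K_A) = 0] ≤ (1-p)^{C(n,2)-C(k,2)}`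
(for `n ≥ k`; the planted input is rejected only when the host has no edge outside `K_A`). [folklore] -/
theorem planted_cliquePlusEdge_le {k : ℕ} (hkn : k ≤ n) {p : ℝ} (hp0 : 0 ≤ p) (hp1 : p ≤ 1) :
    (∑ x : Edges n → Bool, gnpWeight n p x *
        kSubsetProb n k (fun A => cliquePlusEdge n k (x ⊔ cliqueVec A) = false)) ≤
      (1 - p) ^ (n.choose 2 - k.choose 2) := by
  have hC : (0 : ℝ) < n.choose k := by exact_mod_cast Nat.choose_pos hkn
  calc (∑ x : Edges n → Bool, gnpWeight n p x *
        kSubsetProb n k (fun A => cliquePlusEdge n k (x ⊔ cliqueVec A) = false))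
      ≤ ∑ x : Edges n → Bool, gnpWeight n p x *
          kSubsetProb n k (fun A => ∀ e, cliqueVec A e = false → x e = false) := by
        refine sum_le_sum fun x _ => mul_le_mul_of_nonneg_left
          (kSubsetProb_mono_card fun A hAk hA => ?_) (gnpWeight_nonneg hp0 hp1 x)
        exact off_outside_of_cliquePlusEdge_sup hAk hA
    _ = (∑ A ∈ powersetCard k (univ : Finset (Fin n)), gnpProb n p
          (univ.filter fun x : Edges n → Bool => ∀ e, cliqueVec A e = false → x e = false)) /
            (n.choose k : ℝ) :=
        sum_gnpWeight_mul_kSubsetProb p (fun (x : Edges n → Bool) (A : Finset (Fin n)) =>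
          ∀ e, cliqueVec A e = false → x e = false)
    _ = (∑ A ∈ powersetCard k (univ : Finset (Fin n)), (1 - p) ^ (n.choose 2 - k.choose 2)) /
            (n.choose k : ℝ) := by
        congr 1
        refine sum_congr rfl fun A hA => ?_
        rw [gnpProb_off_outside p A, (mem_powersetCard.1 hA).2]
    _ = (1 - p) ^ (n.choose 2 - k.choose 2) := by
        rw [sum_const, card_powersetCard, card_univ, Fintype.card_fin, nsmul_eq_mul,
          mul_div_cancel_left₀ _ hC.ne']

/-! ### The exceptional probability vanishes -/

/-- `p_c · (C(n,2) - C(k,2)) ≥ (n - 1 - k(k-1))/2` for `n ≥ k ≥ 3` (using `p_c ≥ 1/n`). [folklore] -/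
theorem pc_mul_sub_choose_ge {k : ℕ} (hk : 3 ≤ k) (hkn : k ≤ n) :
    ((n : ℝ) - 1 - k * (k - 1)) / 2 ≤ pc n k * ((n.choose 2 - k.choose 2 : ℕ) : ℝ) := by
  have hn1 : 1 ≤ n := by omega
  have hn : (1 : ℝ) ≤ n := by exact_mod_cast hn1
  have hn0 : (0 : ℝ) < n := by linarith
  -- `p_c ≥ 1/n`
  have hpc : (n : ℝ)⁻¹ ≤ pc n k := by
    rw [pc, ← Real.rpow_neg_one]
    refine Real.rpow_le_rpow_of_exponent_le hn ?_
    have hk' : (3 : ℝ) ≤ k := by exact_mod_cast hk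
    rw [neg_div, neg_le_neg_iff, div_le_one (by linarith)]
    linarith
  -- the number of edges outside a `k`-clique, as a real number
  have hm : ((n.choose 2 - k.choose 2 : ℕ) : ℝ) = (n : ℝ) * ((n : ℝ) - 1) / 2 - (k : ℝ) * ((k : ℝ) - 1) / 2 := by
    rw [Nat.cast_sub (Nat.choose_le_choose 2 hkn), Nat.cast_choose_two, Nat.cast_choose_two]
  have hm0 : (0 : ℝ) ≤ ((n.choose 2 - k.choose 2 : ℕ) : ℝ) := Nat.cast_nonneg _
  have hK : (0 : ℝ) ≤ (k : ℝ) * ((k : ℝ) - 1) := by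
    have : (1 : ℝ) ≤ k := by exact_mod_cast (show 1 ≤ k by omega)
    exact mul_nonneg (by linarith) (by linarith)
  calc ((n : ℝ) - 1 - k * (k - 1)) / 2 ≤ ((n : ℝ) - 1) / 2 - (k : ℝ) * ((k : ℝ) - 1) / (2 * n) := by
        have : (k : ℝ) * ((k : ℝ) - 1) / (2 * n) ≤ (k : ℝ) * ((k : ℝ) - 1) / 2 :=
          div_le_div_of_nonneg_left hK (by norm_num) (by linarith)
        linarith
    _ = (n : ℝ)⁻¹ * ((n.choose 2 - k.choose 2 : ℕ) : ℝ) := by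
        rw [hm]
        field_simp
    _ ≤ pc n k * ((n.choose 2 - k.choose 2 : ℕ) : ℝ) := mul_le_mul_of_nonneg_right hpc hm0

/-- **`(1 - p_c)^{C(n,2) - C(k,2)} ≤ exp(-(n - 1 - k(k-1))/2)`** for `n ≥ k ≥ 3`. [folklore] -/
theorem one_sub_pc_pow_le_exp {k : ℕ} (hk : 3 ≤ k) (hkn : k ≤ n) :
    (1 - pc n k) ^ (n.choose 2 - k.choose 2) ≤ Real.exp (-(((n : ℝ) - 1 - k * (k - 1)) / 2)) := by
  have hk2 : 2 ≤ k := by omega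
  have hn1 : 1 ≤ n := by omega
  have h0 : 0 ≤ 1 - pc n k := by linarith [pc_le_one (k := k) hn1 hk2]
  calc (1 - pc n k) ^ (n.choose 2 - k.choose 2)
      ≤ Real.exp (-pc n k) ^ (n.choose 2 - k.choose 2) :=
        pow_le_pow_left₀ h0 (Real.one_sub_le_exp_neg _) _
    _ = Real.exp (-(pc n k * ((n.choose 2 - k.choose 2 : ℕ) : ℝ))) := by
        rw [← Real.exp_nat_mul]
        congr 1
        ring
    _ ≤ Real.exp (-(((n : ℝ) - 1 - k * (k - 1)) / 2)) := by
        rw [Real.exp_le_exp, neg_le_neg_iff]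
        exact pc_mul_sub_choose_ge hk hkn

/-- **`(1 - p_c)^{C(n,2) - C(k,2)} → 0`** for `k ≥ 3`. [folklore] -/
theorem tendsto_one_sub_pc_pow {k : ℕ} (hk : 3 ≤ k) :
    Tendsto (fun n : ℕ => (1 - pc n k) ^ (n.choose 2 - k.choose 2)) atTop (nhds 0) := by
  have hk2 : 2 ≤ k := by omega
  -- the dominating sequence
  have hlin : Tendsto (fun n : ℕ => ((n : ℝ) - 1 - k * (k - 1)) / 2) atTop atTop := by
    refine Tendsto.atTop_div_const (by norm_num) ?_
    have h := tendsto_natCast_atTop_atTop (R := ℝ)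
    refine tendsto_atTop_add_const_right atTop (-(1 + (k : ℝ) * ((k : ℝ) - 1))) h |>.congr fun n => ?_
    ring
  have hexp : Tendsto (fun n : ℕ => Real.exp (-(((n : ℝ) - 1 - k * (k - 1)) / 2))) atTop (nhds 0) :=
    Real.tendsto_exp_atBot.comp (tendsto_neg_atTop_atBot.comp hlin)
  refine tendsto_of_tendsto_of_tendsto_of_le_of_le' tendsto_const_nhds hexp ?_ ?_
  · filter_upwards [eventually_ge_atTop 1] with n hn
    exact pow_nonneg (by linarith [pc_le_one (k := k) hn hk2]) _
  · filter_upwards [eventually_ge_atTop k] with n hkn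
    exact one_sub_pc_pow_le_exp hk hkn

/-- Eventually `(1 - p_c)^{C(n,2) - C(k,2)} ≤ δ`. [folklore] -/
theorem eventually_one_sub_pc_pow_le {k : ℕ} (hk : 3 ≤ k) {δ : ℝ} (hδ : 0 < δ) :
    ∀ᶠ n : ℕ in atTop, (1 - pc n k) ^ (n.choose 2 - k.choose 2) ≤ δ :=
  (tendsto_one_sub_pc_pow hk).eventually (eventually_le_nhds hδ)

/-- `exp(-(n - 1 - K)/2) ≤ n^{-C}` eventually (`log n = o(n)`). [folklore] -/
theorem eventually_exp_le_rpow (K C : ℝ) :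
    ∀ᶠ n : ℕ in atTop, Real.exp (-(((n : ℝ) - 1 - K) / 2)) ≤ (n : ℝ) ^ (-C) := by
  have hc : (0 : ℝ) < 1 / (4 * (|C| + 1)) := by positivity
  have h1 : ∀ᶠ x : ℝ in atTop, ‖Real.log x‖ ≤ 1 / (4 * (|C| + 1)) * ‖id x‖ :=
    Real.isLittleO_log_id_atTop.bound hc
  filter_upwards [tendsto_natCast_atTop_atTop.eventually h1,
    tendsto_natCast_atTop_atTop.eventually (eventually_ge_atTop (2 + 2 * |K|)),
    eventually_ge_atTop 1] with n hlog hK hn1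
  have hn0 : (0 : ℝ) < n := by exact_mod_cast hn1
  simp only [id_eq, Real.norm_eq_abs, Nat.abs_cast] at hlog
  rw [Real.rpow_def_of_pos hn0, Real.exp_le_exp]
  have hfrac : |C| / (|C| + 1) ≤ 1 := by
    rw [div_le_one (by positivity)]
    linarith [abs_nonneg C]
  have h3 : C * Real.log n ≤ (n : ℝ) / 4 := by
    have h4 : C * Real.log n ≤ |C| * |Real.log n| := by
      rw [← abs_mul]
      exact le_abs_self _
    have h5 : |C| * |Real.log n| ≤ |C| * (1 / (4 * (|C| + 1)) * n) :=
      mul_le_mul_of_nonneg_left hlog (abs_nonneg C)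
    have h6 : |C| * (1 / (4 * (|C| + 1)) * n) ≤ (n : ℝ) / 4 :=
      calc |C| * (1 / (4 * (|C| + 1)) * n) = |C| / (|C| + 1) * ((n : ℝ) / 4) := by
            field_simp
        _ ≤ 1 * ((n : ℝ) / 4) := mul_le_mul_of_nonneg_right hfrac (by positivity)
        _ = (n : ℝ) / 4 := one_mul _
    linarith
  have hKle : K ≤ |K| := le_abs_self K
  linarith

/-- Eventually `(1 - p_c)^{C(n,2) - C(k,2)} ≤ n^{-C}`, for every real `C`: the exceptional
probabilities of the witness are below every polynomial accuracy. [folklore] -/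
theorem eventually_one_sub_pc_pow_le_rpow {k : ℕ} (hk : 3 ≤ k) (C : ℝ) :
    ∀ᶠ n : ℕ in atTop, (1 - pc n k) ^ (n.choose 2 - k.choose 2) ≤ (n : ℝ) ^ (-C) := by
  filter_upwards [eventually_exp_le_rpow ((k : ℝ) * ((k : ℝ) - 1)) C, eventually_ge_atTop k]
    with n hn hkn
  exact (one_sub_pc_pow_le_exp hk hkn).trans hn

/-! ### The witness assembled; `PositiveTrigger` is false for general ⋆-closed functions -/

/-- **The witness against `PositiveTrigger` for general closed functions.** For `k ≥ 3`, `a ≥ 1`,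
eventually in `n`: `cliquePlusEdge n k` is monotone, ⋆-closed for `(p_c, n^{-a}, smallI ∪ medJ)`,
errs for `k`-CLIQUE on `G(n,p_c)` with probability `≤ ε_n`, rejects the planted `G ∪ K_A` with
probability `≤ ε_n`, where `ε_n = (1 - p_c)^{C(n,2)-C(k,2)}` (`→ 0` faster than any polynomial), and
rejects EVERY isolated `k`-clique. [folklore] -/
theorem cliquePlusEdge_spec {k a : ℕ} (hk : 3 ≤ k) (ha : 1 ≤ a) :
    ∀ᶠ n : ℕ in atTop,
      Monotone (cliquePlusEdge n k) ∧
      IsClosedFn (pc n k) ((n : ℝ) ^ (-(a : ℝ))) (smallI n k ∪ medJ n k) (cliquePlusEdge n k) ∧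
      gnpProb n (pc n k) (univ.filter fun x => cliquePlusEdge n k x ≠ cliqueFn n k x) ≤
        (1 - pc n k) ^ (n.choose 2 - k.choose 2) ∧
      (∑ x : Edges n → Bool, gnpWeight n (pc n k) x *
          kSubsetProb n k (fun A => cliquePlusEdge n k (x ⊔ cliqueVec A) = false)) ≤
        (1 - pc n k) ^ (n.choose 2 - k.choose 2) ∧
      (∀ A : Finset (Fin n), #A = k → cliquePlusEdge n k (cliqueVec A) = false) ∧
      kSubsetProb n k (fun A => cliquePlusEdge n k (cliqueVec A) = true) = 0 := by
  have hk2 : 2 ≤ k := by omega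
  have ha0 : (0 : ℝ) < a := by exact_mod_cast ha
  have hθ : ∀ᶠ n : ℕ in atTop, (n : ℝ) ^ (-(a : ℝ)) < cfree k :=
    ((tendsto_rpow_neg_atTop ha0).comp tendsto_natCast_atTop_atTop).eventually
      (eventually_lt_nhds (cfree_pos k))
  filter_upwards [hθ, eventually_le_gnpProb_cliqueFree_sup hk2, eventually_ge_atTop k]
    with n hθn hfree hkn
  have hn1 : 1 ≤ n := by omega
  have hp0 := pc_nonneg n k
  have hp1 := pc_le_one hn1 hk2
  refine ⟨monotone_cliquePlusEdge n k, ?_, ?_, planted_cliquePlusEdge_le hkn hp0 hp1,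
    fun A hA => cliquePlusEdge_cliqueVec hA, ?_⟩
  · exact isClosedFn_of_le_cliqueFn hk2 hn1 hfree hθn
      (fun h hh => card_supp_lt_of_mem_smallI_union_medJ hh) fun x hx => cliqueFn_of_cliquePlusEdge hx
  · refine (err_cliquePlusEdge_le hp0 hp1).trans ?_
    have hfm : (n.choose k : ℝ) * pc n k ^ k.choose 2 ≤ 1 :=
      (firstMoment_pc_le hn1 hk2).trans (by
        rw [div_le_one (by positivity)]
        exact_mod_cast Nat.factorial_pos k)
    calc (n.choose k : ℝ) * (pc n k ^ k.choose 2 * (1 - pc n k) ^ (n.choose 2 - k.choose 2))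
        = ((n.choose k : ℝ) * pc n k ^ k.choose 2) * (1 - pc n k) ^ (n.choose 2 - k.choose 2) := by
          ring
      _ ≤ 1 * (1 - pc n k) ^ (n.choose 2 - k.choose 2) :=
          mul_le_mul_of_nonneg_right hfm (pow_nonneg (by linarith) _)
      _ = (1 - pc n k) ^ (n.choose 2 - k.choose 2) := one_mul _
  · unfold kSubsetProb
    rw [filter_false_of_mem, card_empty, Nat.cast_zero, zero_div]
    intro A hA
    rw [cliquePlusEdge_cliqueVec (mem_powersetCard.1 hA).2]
    exact Bool.false_ne_true

/-- **`PositiveTrigger` is FALSE for general ⋆-closed functions — for EVERY `k ≥ 3`, `a ≥ 1`,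
`δ > 0`, `η > 0`.** Eventually in `n` there is a monotone `f` (namely `cliquePlusEdge n k`), ⋆-closed
for `(p_c, n^{-a}, smallI ∪ medJ)`, `δ`-accurate, accepting the planted clique up to `δ`, that accepts
NO isolated clique; so the matrix of `stub_positiveTrigger` with the program `(gs, out, ap)` and its
hypotheses replaced by their consequences for the output wire (`Monotone`, `IsClosedFn`) does not hold
eventually, whatever `k`. [folklore] -/
theorem positiveTrigger_false_forall {k a : ℕ} (hk : 3 ≤ k) (ha : 1 ≤ a) {δ η : ℝ} (hδ : 0 < δ)
    (hη : 0 < η) :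
    ¬ ∀ᶠ n : ℕ in atTop, ∀ f : (Edges n → Bool) → Bool, Monotone f →
        IsClosedFn (pc n k) ((n : ℝ) ^ (-(a : ℝ))) (smallI n k ∪ medJ n k) f →
        gnpProb n (pc n k) (univ.filter fun x => f x ≠ cliqueFn n k x) ≤ δ →
        (∑ x : Edges n → Bool, gnpWeight n (pc n k) x *
            kSubsetProb n k (fun A => f (x ⊔ cliqueVec A) = false)) ≤ δ →
          η ≤ kSubsetProb n k (fun A => f (cliqueVec A) = true) := by
  intro h
  obtain ⟨n, hn, ⟨hmono, hclosed, herr, hpl, -, hzero⟩, hsmall⟩ :=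
    (h.and ((cliquePlusEdge_spec hk ha).and (eventually_one_sub_pc_pow_le hk hδ))).exists
  have := hn (cliquePlusEdge n k) hmono hclosed (herr.trans hsmall) (hpl.trans hsmall)
  rw [hzero] at this
  exact absurd this (not_le.2 hη)

/-- **… and polynomial (indeed any `n^{-C}`) accuracy does not help**: for every `k ≥ 3`, `a ≥ 1`,
real `C` and `η > 0`, the program-free `PositiveTrigger` with accuracy and planted rejection `≤ n^{-C}`
still fails eventually (same witness). Addresses the line card's "first milestone" (the stub at
`δ = n^{-C_k}`): that milestone, too, must use the program. [folklore] -/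
theorem positiveTrigger_false_forall_rpow {k a : ℕ} (hk : 3 ≤ k) (ha : 1 ≤ a) (C : ℝ) {η : ℝ}
    (hη : 0 < η) :
    ¬ ∀ᶠ n : ℕ in atTop, ∀ f : (Edges n → Bool) → Bool, Monotone f →
        IsClosedFn (pc n k) ((n : ℝ) ^ (-(a : ℝ))) (smallI n k ∪ medJ n k) f →
        gnpProb n (pc n k) (univ.filter fun x => f x ≠ cliqueFn n k x) ≤ (n : ℝ) ^ (-C) →
        (∑ x : Edges n → Bool, gnpWeight n (pc n k) x *
            kSubsetProb n k (fun A => f (x ⊔ cliqueVec A) = false)) ≤ (n : ℝ) ^ (-C) →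
          η ≤ kSubsetProb n k (fun A => f (cliqueVec A) = true) := by
  intro h
  obtain ⟨n, hn, ⟨hmono, hclosed, herr, hpl, -, hzero⟩, hsmall⟩ :=
    (h.and ((cliquePlusEdge_spec hk ha).and (eventually_one_sub_pc_pow_le_rpow hk C))).exists
  have := hn (cliquePlusEdge n k) hmono hclosed (herr.trans hsmall) (hpl.trans hsmall)
  rw [hzero] at this
  exact absurd this (not_le.2 hη)

/-- **`stub_positiveTrigger` minus the program is FALSE** (the quantifier prefix of the registered
stub, skeleton `Lines/self-noise-closure.lean` as of 2026-08-16T03:28Z: `∀ c k₀ ∃ k ≥ k₀ ∃ a ≥ k + c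
∃ δ > 0 ∃ η > 0 ∀ᶠ n`, with `(gs, out, ap, WF, basis, length ≤ n^c, OutOK, gate equations,
StarApproxInv)` replaced by `f` monotone and ⋆-closed). Any proof of the stub must therefore use the
wire structure / the length bound, not only the listed properties of `f̄ = ap out`. [folklore] -/
theorem positiveTrigger_false_without_program :
    ¬ ∀ c k₀ : ℕ, ∃ k : ℕ, k₀ ≤ k ∧ ∃ a : ℕ, k + c ≤ a ∧ ∃ δ : ℝ, 0 < δ ∧ ∃ η : ℝ, 0 < η ∧
      ∀ᶠ n : ℕ in atTop, ∀ f : (Edges n → Bool) → Bool, Monotone f →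
        IsClosedFn (pc n k) ((n : ℝ) ^ (-(a : ℝ))) (smallI n k ∪ medJ n k) f →
        gnpProb n (pc n k) (univ.filter fun x => f x ≠ cliqueFn n k x) ≤ δ →
        (∑ x : Edges n → Bool, gnpWeight n (pc n k) x *
            kSubsetProb n k (fun A => f (x ⊔ cliqueVec A) = false)) ≤ δ →
          η ≤ kSubsetProb n k (fun A => f (cliqueVec A) = true) := by
  intro h
  obtain ⟨k, hk, a, hka, δ, hδ, η, hη, hev⟩ := h 0 3
  exact positiveTrigger_false_forall hk (by omega) hδ hη hev

/-- The same for the prefix of the stub as REGISTERED on the ledger (skeleton sha `38768f89…`,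
`∃ a ≥ k + c + 1`). [folklore] -/
theorem positiveTrigger_false_without_program' :
    ¬ ∀ c k₀ : ℕ, ∃ k : ℕ, k₀ ≤ k ∧ ∃ a : ℕ, k + c + 1 ≤ a ∧ ∃ δ : ℝ, 0 < δ ∧ ∃ η : ℝ, 0 < η ∧
      ∀ᶠ n : ℕ in atTop, ∀ f : (Edges n → Bool) → Bool, Monotone f →
        IsClosedFn (pc n k) ((n : ℝ) ^ (-(a : ℝ))) (smallI n k ∪ medJ n k) f →
        gnpProb n (pc n k) (univ.filter fun x => f x ≠ cliqueFn n k x) ≤ δ →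
        (∑ x : Edges n → Bool, gnpWeight n (pc n k) x *
            kSubsetProb n k (fun A => f (x ⊔ cliqueVec A) = false)) ≤ δ →
          η ≤ kSubsetProb n k (fun A => f (cliqueVec A) = true) := by
  intro h
  obtain ⟨k, hk, a, hka, δ, hδ, η, hη, hev⟩ := h 0 3
  exact positiveTrigger_false_forall hk (by omega) hδ hη hev

end Targets

/-! ## (z) Near-misses / frontier (the only `sorry`s of this file) -/

/-- **FRONTIER (near-miss, open here): the first contentful instance of the crux is `c = 2`.**
`∃ k ≥ 3, ∃ δ > 0, LowerBoundAt 2 k δ` — every δ-accurate monotone circuit has more than `n²` gates.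
Obstruction: a circuit with `n²` gates can read all `C(n,2)` edges, so the locality argument of (h)
is dead; the claim is already a genuine average-case monotone lower bound at a single threshold, for
which no technique is in print below Rossman's two-threshold method (which needs the subcritical
sprinkle as negative instance). What was tried: (h) locality (fails at `|F| ≍ n²`); transplanting
`Rossman2010_twoThresholds` (needs accuracy at a second density); counting the live threshold gates
(no bound on how `∧₂` aggregates `Θ(k²/√m)` advantages, TRIAGE-r1-1). Expected TRUE for large `k`.
[folklore] -/
theorem frontier_lowerBoundAt_two : ∃ k : ℕ, 3 ≤ k ∧ ∃ δ : ℝ, 0 < δ ∧ LowerBoundAt 2 k δ := by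
  sorry

end

end Summit.PneNP.PneNP.Cruxes.SingleThreshold.Disproof
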